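import Literature.MathematicalPhysics.PowerSystems.DAPISecondaryControlStability
import Literature.MathematicalPhysics.PowerSystems.DroopSyncExponentialStabilityLoads
import HarnessLib

/-!
# SPDB2013 Theorem 8 (ii), stability clause, WITH LOAD NODES (`V_L ≠ ∅`): the DAPI-controlled
# droop network with constant-power loads, its Kron-extended closed loop near `(θ*, p̃ = 0)`, the
# spectral lemma `J = −Z⁻¹X₁X₂` with `L_red(θ*)`, and local exponential stability modulo rotation

Topic `Literature/MathematicalPhysics/PowerSystems` (LADDER-GRIDFUSION rung G3 «inverter-based /
low-inertia», secondary frequency control; seat gridfusion-lit-2, g11).  Companion of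
`DAPISecondaryControlStability.lean` (Theorem 8 (ii) for ALL-INVERTER networks, `V_L = ∅`) and of
`DroopSyncExponentialStabilityLoads.lean` (Theorem 2 (i) WITH load nodes: the differential-algebraic
closed loop, the Kron-extended field `kronField θ*`, `L_red(θ*) = L_II − L_IL L_LL⁻¹ L_LI`).  This
file is the printed generality of Theorem 8's stability clause: inverters `V_I = {D_i > 0}` carry the
droop AND the secondary variable `p_i`, loads `V_L = {D_i = 0}` are algebraic power-balance rows.
Everything is PROVED (no named fact, no `sorry`), through Lyapunov's indirect method in the
rotation-quotient form (`Literature/Analysis/ODE/LyapunovIndirectMethod.lean`).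

SOURCE (held LaTeX text of arXiv:1206.5033 = Automatica 49 (2013) 2603–2611, read on the page this
session) [SimpsonporcoDorflerBullo2013]: §5 Theorem 8 (p0012 L56–L67: «(ii) Stability of DAPI
Controller: … the system (load – closed loop)–(secondary control – closed loop) possess a locally
exponentially stable and unique equilibrium `(θ*, p*) ∈ Δ_G(γ) × ℝ^{|V_I|}`»); App. C (p0016 L1–L40):
the closed loop in the error coordinates `p̃ = p − D_Iω_avg`,
`𝒟[0; θ̇_I] = P̃ − P_e − [0; p̃]`, `K p̃' = P̃_I − P_{e,I} − (I + L_cD_I⁻¹)p̃` (eq. (rot2));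
«we linearize the DAE … about the regular fixed point `(θ*, p̃*)` and eliminate the resulting
algebraic equations, as in the proof of Theorem 2. The Jacobian `J(θ*, p̃*)` of the reduced system
… can then be factored as `J = −Z⁻¹X`, `Z = blkdiag(I, K)`,
`X = X₁X₂ = [[D_I⁻¹, I],[I, L_c + D_I]] · blkdiag(L_red(θ*), D_I⁻¹)`»; «`X₂` is positive
semidefinite with kernel spanned by `(𝟙, 0)` … `X₁` is positive semidefinite with kernel spanned by
`(−D_I𝟙, 𝟙)`. Since `image(L_red(θ*)) = 𝟙^⊥`, … `X₂v` is never in the kernel of `X₁`»; continuity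
argument in `ε` ⇒ «all eigenvalues are real and negative … modulo rotational symmetry … locally
exponentially stable».

WHAT IS PROVED, for `W : DAPINetwork n` with `D_i ≥ 0` (inverters `Inv = {D_i > 0}` carrying the
secondary variables, loads `Load = {¬ D_i > 0}`), at least one inverter, `|Y|` symmetric, gains
`k_i > 0` and symmetric communication weights `c_ij` among the inverters, an (Aux)-equilibrium `θ*`:
* §1 the KRON-EXTENDED CLOSED LOOP `dlField θ*` on the state space `(θ, p̃) ∈ ℝⁿ × ℝ^{Inv}`
  (inverter rows `F_I − p̃/D_I` with `F_I` the extension `kronFieldI θ*` of Theorem 2's file, load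
  rows `G(θ)(F_I − p̃/D_I) + L_LL(θ*)⁻¹m_L(θ)` — the velocity forced by the constraints —, p-rows
  `(D_I(F_I − p̃/D_I) − L_cD_I⁻¹p̃)/K`; on the constraint manifold `m_L = 0` these are the printed
  equations (rot2)), its rotational symmetry (`dlField_add_rot`), the conserved quantity
  `Σ_{V_I} D_iθ_i − Σ_{V_I} k_ip̃_i` (`dlWeights_dotProduct_dlField`), the rest point
  (`dlField_equilibrium`), the Jacobian `dlJac θ*` and **`hasFDerivAt_dlField`**;
* §2 **`dlJac_eig_re_neg_or_rotation`** — the spectral sentence PROVED (no continuity argument):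
  an eigenpair `(μ, (v, q))` either lives off the linearised constraint (`μ = −1`) or on it, where
  with `u = L(θ*)v` (`u_L = 0`) and `w = (u_I, D_I⁻¹q)` the Hermitian identity
  `⟨w, X₁w⟩ = −μ(v^*L(θ*)v + Σ k_iD_i|w₂,i|²)` and the two kernel certificates give `Re μ < 0` or
  the rotation mode `(𝟙, 0)` with `μ = 0`;
* §3 **`dl_expStable_within_leaf`**, **`dl_expStable_modRotation_of_within_leaf`** and
  **`dlEquilibrium_locally_expStable_of_certificates`** / **`dlEquilibrium_locally_expStable`**
  (printed hypotheses: `θ* ∈ Δ_G(γ)`, `γ < π/2`, `a ≥ 0` connected, `c ≥ 0` connected among the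
  inverters): `∃ ρ, k, λ > 0`, every solution `x = (θ, p̃)` of the Kron-extended closed loop on
  `[0, T]` with `‖x(0) − (θ*, 0)‖ < ρ` satisfies
  `‖x(t) − (θ* + c𝟙, 0)‖ ≤ k‖x(0) − (θ* + c𝟙, 0)‖e^{−λt}`,
  `c = (Σ_{V_I} D_i(θ_i(0) − θ*_i) − Σ_{V_I} k_ip̃_i(0))/Σ_{V_I} D_i`.
* §4 THE PRINTED DIFFERENTIAL-ALGEBRAIC CLOSED LOOP (load – closed loop)–(secondary control –
  closed loop): `IsSolutionLoadsAt` (inverter rows `D_iθ̇_i = P*_i − p_i − P_e,i`, secondary rows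
  `k_iṗ_i = P*_i − p_i − P_e,i − Σ_{V_I} c_ij(p_i/D_i − p_j/D_j)`, load rows `0 = P*_l − P_e,l`);
  `loadVelocity_eq_elim_mulVec` (the differentiated constraints solved for the load velocities,
  `θ̇_L = −L_LL⁻¹L_LIθ̇_I`), **`hasDerivAt_lphase_of_isSolutionLoadsAt`** (a DAE solution, in the
  error coordinates `(θ, p − D_Iω_avg)`, solves `x' = dlField θ* x` while `L_LL(θ(t))` is
  invertible), and **`equilibrium_locally_expStable_loads_of_certificates`** /
  **`equilibrium_locally_expStable_loads`** (printed hypotheses): `∃ ρ, k, λ > 0`, EVERY solution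
  `(θ, p)` of the DAE with `‖(θ(0) − θ*, p(0) − D_Iω_avg)‖ < ρ` satisfies for all `t ≥ 0`
  `‖(θ(t) − (θ* + c𝟙), p(t) − D_Iω_avg)‖ ≤ k‖(θ(0) − (θ* + c𝟙), p(0) − D_Iω_avg)‖e^{−λt}`,
  `c = (Σ_i D_i(θ_i(0) − θ*_i) − Σ_{V_I} k_i(p_i(0) − D_iω_avg))/Σ_i D_i` — a continuity (bootstrap)
  argument keeps `L_LL(θ(t))` invertible along the solution («regular fixed point»).

THREE COLUMNS.  Mathematics about MODEL «droop-controlled inverters with the DAPI secondary loop and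
constant-power (frequency-independent) loads as algebraic rows; lossless inductive lines, constant
voltage amplitudes».  `ρ, k, λ` are EXISTENTIAL.  Nothing here says a microgrid is stable.

## Mathlib / tree search

Tree (used by name): `DroopNetwork.{Inv, Load, lapLL, lapLI, lapIL, mismatch, elim, kronFieldI,
kronField, kronJac, kronJacI, kronJacL, isUnit_lapLL_det, lapLL_mul_elim, sum_lapIL_mul_inv,
hasFDerivAt_kronField, continuousAt_elim, kronField_equilibrium, kronField_add_const,
dc_dotProduct_kronField, mismatch_eq_zero_of_isAuxEquilibrium, sum_mismatch_eq_zero, lap_mulVec,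
linWeight_symm, re_conj_lapForm, posCurvature_of_arc}` (`DroopSyncExponentialStabilityLoads.lean`,
`DroopSyncExponentialStability.lean`), `DAPINetwork` (`DAPISecondaryControlStability.lean`),
`ClassicalModel.CouplingConnected`,
`Literature.Analysis.ODE.exists_expStable_within_of_eig_re_neg_or_smul`.  The private algebra of the
two companions (complexified rows, Laplacian forms, the product rule at a zero) is re-proved here.

## References

* J. W. Simpson-Porco, F. Dörfler, F. Bullo, *Synchronization and power sharing for droop-controlled
  inverters in islanded microgrids*, Automatica 49 (2013) 2603–2611 = arXiv:1206.5033, §5 Theorem 8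
  and App. C (held text p0012, p0016 L1–L40). [SimpsonporcoDorflerBullo2013]
* H. K. Khalil, *Nonlinear Systems*, 3rd ed., Theorem 4.7. [Khalil2002]

AI-produced formalisation (LADDER-GRIDFUSION seat gridfusion-lit-2 g11, 2026-08-28).
-/

noncomputable section

open Set Filter Topology Finset
open scoped Matrix ComplexConjugate BigOperators

namespace Literature.MathematicalPhysics.PowerSystems

namespace DAPINetwork

variable {n : ℕ} (W : DAPINetwork n)

/-! ## §1 The Kron-extended closed loop with secondary variables, its symmetry, conserved quantity,
rest point and Jacobian -/

/-- The state `(θ, p̃)`: all bus angles and the inverters' secondary variables, as ONE function on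
`Fin n ⊕ Inv` (sup norm). [cite: SimpsonporcoDorflerBullo2013, App. C (error coordinates `p̃ = p − D_Iω_avg`, state `(θ, p̃) ∈ 𝕋ⁿ × ℝ^{|V_I|}`)] -/
def lphase (θ : Fin n → ℝ) (q : W.Inv → ℝ) : Fin n ⊕ W.Inv → ℝ := Sum.elim θ q

/-- Inverter angle rows of the Kron-extended closed loop: `F_I,i(θ) − p̃_i/D_i`
(`D_iθ̇_i = P̃_i − P_e,i − p̃_i`, with Theorem 2's extension term `−(L_IL L_LL(θ*)⁻¹ m_L)_i/D_i`
vanishing on the constraint manifold). [cite: SimpsonporcoDorflerBullo2013, App. C eq. (load – closed loop – rot2)] -/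
def dlFieldI (θs θ : Fin n → ℝ) (q : W.Inv → ℝ) (i : W.Inv) : ℝ :=
  W.kronFieldI θs θ i - q i / W.Dc i.1

/-- Load angle rows: `G(θ)(F_I − p̃/D_I) + L_LL(θ*)⁻¹ m_L(θ)` — the velocity the constraints
`m_L(θ(t)) = 0` force on the load angles. [cite: SimpsonporcoDorflerBullo2013, App. C («eliminate the resulting algebraic equations, as in the proof of Theorem 2»)] -/
def dlFieldL (θs θ : Fin n → ℝ) (q : W.Inv → ℝ) : W.Load → ℝ :=
  W.elim θ *ᵥ W.dlFieldI θs θ q + (W.lapLL θs)⁻¹ *ᵥ fun l : W.Load => W.mismatch θ l.1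

/-- Secondary-variable rows: `(D_i(F_I,i − p̃_i/D_i) − Σ_j c_ij(p̃_i/D_i − p̃_j/D_j))/k_i`
(`k_ip̃'_i = D_iθ̇_i − (L_cD_I⁻¹p̃)_i`). [cite: SimpsonporcoDorflerBullo2013, §5 eq. (secondary control) and App. C eq. (secondary control – closed loop – rot2)] -/
def dlFieldP (θs θ : Fin n → ℝ) (q : W.Inv → ℝ) (i : W.Inv) : ℝ :=
  (W.Dc i.1 * W.dlFieldI θs θ q i - ∑ j : W.Inv, W.comm i.1 j.1 * (q i / W.Dc i.1 - q j / W.Dc j.1))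
    / W.kgain i.1

/-- **The Kron-extended DAPI closed loop with loads** on the state space `Fin n ⊕ Inv`.
[cite: SimpsonporcoDorflerBullo2013, App. C eqs. (rot2)] -/
def dlField (θs : Fin n → ℝ) (x : Fin n ⊕ W.Inv → ℝ) : Fin n ⊕ W.Inv → ℝ :=
  Sum.elim
    (fun j => if h : 0 < W.Dc j then W.dlFieldI θs (fun j' => x (Sum.inl j')) (fun i => x (Sum.inr i)) ⟨j, h⟩
      else W.dlFieldL θs (fun j' => x (Sum.inl j')) (fun i => x (Sum.inr i)) ⟨j, h⟩)
    (fun i => W.dlFieldP θs (fun j' => x (Sum.inl j')) (fun i' => x (Sum.inr i')) i)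

/-- The rotation mode `(𝟙, 0)`. [cite: SimpsonporcoDorflerBullo2013, App. C («modulo rotational symmetry»)] -/
def dlRot : Fin n ⊕ W.Inv → ℝ := Sum.elim (fun _ => 1) (fun _ => 0)

/-- The weights `(D, −k_I)` of the conserved quantity `Σ_i D_iθ_i − Σ_{V_I} k_ip̃_i` (`D_l = 0` at
loads). [cite: SimpsonporcoDorflerBullo2013, App. C («`X₁` … kernel spanned by `(−D_I𝟙, 𝟙)`»)] -/
def dlWeights : Fin n ⊕ W.Inv → ℝ := Sum.elim W.Dc (fun i => -W.kgain i.1)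

/-- The communication Laplacian among the inverters: `(L_c y)_i = Σ_j c_ij(y_i − y_j)`.
[cite: SimpsonporcoDorflerBullo2013, §5 («`L_c ∈ ℝ^{|V_I|×|V_I|}` the Laplacian matrix»)] -/
def commLapI : Matrix W.Inv W.Inv ℝ :=
  fun i j => (if i = j then ∑ k : W.Inv, W.comm i.1 k.1 else 0) - W.comm i.1 j.1

/-- **The Jacobian of the Kron-extended closed loop at `(θ*, 0)`**: angle block `kronJac θ*`
(`−D_I⁻¹L_red(θ*)` on the inverters), `−D_I⁻¹` / `−G(θ*)D_I⁻¹` couplings to `p̃`, p-rows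
`(D_I·kronJacI, −(I + L_cD_I⁻¹))/K` — the printed `−Z⁻¹X₁X₂` extended by the load directions.
[cite: SimpsonporcoDorflerBullo2013, App. C («`J(θ*, p̃*) = −Z⁻¹X`»)] -/
def dlJac (θs : Fin n → ℝ) : Matrix (Fin n ⊕ W.Inv) (Fin n ⊕ W.Inv) ℝ :=
  Matrix.fromBlocks (W.kronJac θs)
    (fun j i' => if h : 0 < W.Dc j then (if (⟨j, h⟩ : W.Inv) = i' then -(W.Dc j)⁻¹ else 0)
      else -(W.elim θs ⟨j, h⟩ i' / W.Dc i'.1))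
    (fun i j' => W.Dc i.1 * W.kronJacI θs i j' / W.kgain i.1)
    (fun i i' => -((if i = i' then 1 else 0) + W.commLapI i i' / W.Dc i'.1) / W.kgain i.1)

variable {W}

/-- Splitting a sum over the nodes into inverter and load nodes. [folklore] -/
private theorem sum_split' {M : Type*} [AddCommMonoid M] (f : Fin n → M) :
    ∑ j, f j = ∑ i : W.Inv, f i.1 + ∑ l : W.Load, f l.1 :=
  (Fintype.sum_subtype_add_sum_subtype (fun j => 0 < W.Dc j) f).symm

/-- `(L_c y)_i = Σ_j c_ij(y_i − y_j)`. [cite: SimpsonporcoDorflerBullo2013, §5] -/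
theorem commLapI_mulVec (y : W.Inv → ℝ) (i : W.Inv) :
    (W.commLapI *ᵥ y) i = ∑ j : W.Inv, W.comm i.1 j.1 * (y i - y j) := by
  simp only [Matrix.mulVec, dotProduct, commLapI, sub_mul, Finset.sum_sub_distrib, ite_mul,
    zero_mul, Finset.sum_ite_eq, Finset.mem_univ, if_true, mul_sub, Finset.sum_mul]

/-- Angle rows of the field at inverters. [folklore] -/
private theorem dlField_inl_inv (θs : Fin n → ℝ) (x : Fin n ⊕ W.Inv → ℝ) (i : W.Inv) :
    W.dlField θs x (Sum.inl i.1)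
      = W.dlFieldI θs (fun j' => x (Sum.inl j')) (fun i' => x (Sum.inr i')) i := by
  simp only [dlField, Sum.elim_inl, dif_pos i.2]

/-- Angle rows of the field at loads. [folklore] -/
private theorem dlField_inl_load (θs : Fin n → ℝ) (x : Fin n ⊕ W.Inv → ℝ) (l : W.Load) :
    W.dlField θs x (Sum.inl l.1)
      = W.dlFieldL θs (fun j' => x (Sum.inl j')) (fun i' => x (Sum.inr i')) l := by
  simp only [dlField, Sum.elim_inl, dif_neg l.2]

/-- Rotational symmetry: a uniform shift of all angles changes nothing.
[cite: SimpsonporcoDorflerBullo2013, App. C («modulo rotational symmetry»)] -/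
theorem dlField_add_rot (θs : Fin n → ℝ) (x : Fin n ⊕ W.Inv → ℝ) (c : ℝ) :
    W.dlField θs (fun kk => x kk + c * W.dlRot kk) = W.dlField θs x := by
  have hθ : (fun j' => x (Sum.inl j') + c * W.dlRot (Sum.inl j')) = fun j' => x (Sum.inl j') + c :=
    funext fun j' => by simp [dlRot]
  have hq : (fun i' : W.Inv => x (Sum.inr i') + c * W.dlRot (Sum.inr i')) = fun i' => x (Sum.inr i') :=
    funext fun i' => by simp [dlRot]
  have hkI : W.kronFieldI θs (fun j' => x (Sum.inl j') + c) = W.kronFieldI θs fun j' => x (Sum.inl j') := by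
    funext i
    have h := congrFun (DroopNetwork.kronField_add_const (N := W.toDroopNetwork) θs
      (fun j' => x (Sum.inl j')) c) i.1
    simp only [DroopNetwork.kronField, dif_pos i.2] at h
    exact h
  have hI : W.dlFieldI θs (fun j' => x (Sum.inl j') + c) (fun i' => x (Sum.inr i'))
      = W.dlFieldI θs (fun j' => x (Sum.inl j')) (fun i' => x (Sum.inr i')) := by
    funext i; simp only [dlFieldI, hkI]
  have helim : W.elim (fun j' => x (Sum.inl j') + c) = W.elim fun j' => x (Sum.inl j') := by
    simp only [DroopNetwork.elim, DroopNetwork.lapLL_add_const, DroopNetwork.lapLI_add_const]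
  have hm : (fun l : W.Load => W.mismatch (fun j' => x (Sum.inl j') + c) l.1)
      = fun l : W.Load => W.mismatch (fun j' => x (Sum.inl j')) l.1 := by
    funext l; exact congrFun (DroopNetwork.mismatch_add_const (N := W.toDroopNetwork) _ c) l.1
  funext kk
  cases kk with
  | inl j =>
    by_cases hj : 0 < W.Dc j
    · simp only [dlField, Sum.elim_inl, dif_pos hj]
      rw [hθ, hq, hI]
    · simp only [dlField, Sum.elim_inl, dif_neg hj]
      rw [hθ, hq]
      simp only [dlFieldL, hI, helim, hm]
  | inr i =>
    simp only [dlField, Sum.elim_inr]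
    rw [hθ, hq]
    simp only [dlFieldP, hI]

/-- **The conserved quantity** `Σ_i D_iθ_i − Σ_{V_I} k_ip̃_i`: its derivative along the extended
closed loop is `Σ_{V_I}(L_cD_I⁻¹p̃)_i = 0` (symmetric `c`, `k_i ≠ 0`) — the left null vector
`(D_I𝟙, −𝟙)ᵀ` of the printed `X₁`, read through `Z = blkdiag(I, K)`; the load angles weigh `0`.
[cite: SimpsonporcoDorflerBullo2013, App. C («`X₁` is positive semidefinite with kernel spanned by `(−D_I𝟙, 𝟙)`»)] -/
theorem dlWeights_dotProduct_dlField (hD : ∀ i, 0 ≤ W.Dc i) (hk : ∀ i : W.Inv, W.kgain i.1 ≠ 0)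
    (hc : ∀ i j : W.Inv, W.comm i.1 j.1 = W.comm j.1 i.1) (θs : Fin n → ℝ)
    (x : Fin n ⊕ W.Inv → ℝ) : W.dlWeights ⬝ᵥ W.dlField θs x = 0 := by
  classical
  set θ : Fin n → ℝ := fun j' => x (Sum.inl j') with hθ
  set q : W.Inv → ℝ := fun i' => x (Sum.inr i') with hq
  have hl : ∀ l : W.Load, W.Dc l.1 * W.dlField θs x (Sum.inl l.1) = 0 := fun l => by
    rw [DroopNetwork.dc_load (N := W.toDroopNetwork) hD l, zero_mul]
  have hp : ∀ i : W.Inv, -W.kgain i.1 * W.dlField θs x (Sum.inr i)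
      = -(W.Dc i.1 * W.dlFieldI θs θ q i - ∑ j : W.Inv, W.comm i.1 j.1 * (q i / W.Dc i.1 - q j / W.Dc j.1)) := by
    intro i
    simp only [dlField, Sum.elim_inr, dlFieldP]
    field_simp [hk i]
    rfl
  have hanti : ∑ i : W.Inv, ∑ j : W.Inv, W.comm i.1 j.1 * (q i / W.Dc i.1 - q j / W.Dc j.1) = 0 := by
    have hswap : ∑ i : W.Inv, ∑ j : W.Inv, W.comm i.1 j.1 * (q i / W.Dc i.1 - q j / W.Dc j.1)
        = ∑ i : W.Inv, ∑ j : W.Inv, W.comm j.1 i.1 * (q j / W.Dc j.1 - q i / W.Dc i.1) := Finset.sum_comm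
    have hneg : ∑ i : W.Inv, ∑ j : W.Inv, W.comm j.1 i.1 * (q j / W.Dc j.1 - q i / W.Dc i.1)
        = -∑ i : W.Inv, ∑ j : W.Inv, W.comm i.1 j.1 * (q i / W.Dc i.1 - q j / W.Dc j.1) := by
      rw [← Finset.sum_neg_distrib]
      refine Finset.sum_congr rfl fun i _ => ?_
      rw [← Finset.sum_neg_distrib]
      refine Finset.sum_congr rfl fun j _ => ?_
      rw [hc j i]; ring
    linarith
  rw [dotProduct, Fintype.sum_sum_type]
  simp only [dlWeights, Sum.elim_inl, Sum.elim_inr]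
  rw [sum_split' (W := W) (fun j => W.Dc j * W.dlField θs x (Sum.inl j))]
  simp only [hl, Finset.sum_const_zero, add_zero, hp, Finset.sum_neg_distrib, Finset.sum_sub_distrib,
    hanti, sub_zero, dlField_inl_inv]
  ring

/-- `Σ dlWeights · (𝟙, 0) = Σ_i D_i`. [folklore] -/
private theorem dlWeights_dotProduct_dlRot : W.dlWeights ⬝ᵥ W.dlRot = ∑ i, W.Dc i := by
  simp [dotProduct, Fintype.sum_sum_type, dlWeights, dlRot]

/-- At `(θ*, 0)` with `θ*` an (Aux)-equilibrium the extended closed loop is at rest.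
[cite: SimpsonporcoDorflerBullo2013, App. C («`p̃ = p̃* = 0` and `P̃ − P_e = 0`»)] -/
theorem dlField_equilibrium {θs : Fin n → ℝ} (hθs : W.IsAuxEquilibrium θs) :
    W.dlField θs (W.lphase θs 0) = 0 := by
  have hm := DroopNetwork.mismatch_eq_zero_of_isAuxEquilibrium (N := W.toDroopNetwork) hθs
  have hkI : ∀ i : W.Inv, W.kronFieldI θs θs i = 0 := fun i => by
    have h := congrFun (DroopNetwork.kronField_equilibrium (N := W.toDroopNetwork) hθs θs) i.1
    simp only [DroopNetwork.kronField, dif_pos i.2, Pi.zero_apply] at h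
    exact h
  have hθ : (fun j' => W.lphase θs 0 (Sum.inl j')) = θs := funext fun j' => by simp [lphase]
  have hq : (fun i' : W.Inv => W.lphase θs 0 (Sum.inr i')) = 0 := funext fun i' => by simp [lphase]
  have hI : W.dlFieldI θs θs 0 = 0 := by
    funext i; simp [dlFieldI, hkI]
  funext kk
  cases kk with
  | inl j =>
    by_cases hj : 0 < W.Dc j
    · simp only [dlField, Sum.elim_inl, dif_pos hj, Pi.zero_apply]
      rw [hθ, hq, hI]; rfl
    · simp only [dlField, Sum.elim_inl, dif_neg hj, Pi.zero_apply]
      rw [hθ, hq]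
      simp only [dlFieldL, hI, Matrix.mulVec_zero, zero_add]
      simp [Matrix.mulVec, dotProduct, hm]
  | inr i =>
    simp only [dlField, Sum.elim_inr, Pi.zero_apply]
    rw [hθ, hq]
    simp [dlFieldP, hI]

/-! ### The rows of the Jacobian -/

/-- Inverter angle row: `(J h)_θ,i = (kronJac θ* h_θ)_i − h_p,i/D_i`. [cite: SimpsonporcoDorflerBullo2013, App. C] -/
theorem dlJac_mulVec_inl_inv (θs : Fin n → ℝ) (h : Fin n ⊕ W.Inv → ℝ) (i : W.Inv) :
    (W.dlJac θs *ᵥ h) (Sum.inl i.1)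
      = (W.kronJac θs *ᵥ fun j => h (Sum.inl j)) i.1 - h (Sum.inr i) / W.Dc i.1 := by
  simp only [dlJac, Matrix.fromBlocks_mulVec, Sum.elim_inl, Pi.add_apply]
  simp only [Matrix.mulVec, dotProduct, Function.comp_apply, dif_pos i.2, Subtype.coe_eta]
  have h1 : ∀ i' : W.Inv, (if i = i' then -(W.Dc i.1)⁻¹ else 0) * h (Sum.inr i')
      = if i = i' then -(W.Dc i.1)⁻¹ * h (Sum.inr i') else 0 := fun i' => by split_ifs <;> ring
  simp only [h1, Finset.sum_ite_eq, Finset.mem_univ, if_true]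
  ring

/-- Load angle row: `(J h)_θ,l = (kronJac θ* h_θ)_l − Σ_i G(θ*)_li h_p,i/D_i`. [cite: SimpsonporcoDorflerBullo2013, App. C] -/
theorem dlJac_mulVec_inl_load (θs : Fin n → ℝ) (h : Fin n ⊕ W.Inv → ℝ) (l : W.Load) :
    (W.dlJac θs *ᵥ h) (Sum.inl l.1)
      = (W.kronJac θs *ᵥ fun j => h (Sum.inl j)) l.1
        - ∑ i : W.Inv, W.elim θs l i * (h (Sum.inr i) / W.Dc i.1) := by
  simp only [dlJac, Matrix.fromBlocks_mulVec, Sum.elim_inl, Pi.add_apply]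
  simp only [Matrix.mulVec, dotProduct, Function.comp_apply, dif_neg l.2]
  rw [sub_eq_add_neg, ← Finset.sum_neg_distrib]
  congr 1
  refine Finset.sum_congr rfl fun i _ => ?_
  ring

/-- Secondary row: `(J h)_p,i = (D_i(kronJacI θ* h_θ)_i − h_p,i − Σ_j c_ij(h_p,i/D_i − h_p,j/D_j))/k_i`.
[cite: SimpsonporcoDorflerBullo2013, App. C] -/
theorem dlJac_mulVec_inr (θs : Fin n → ℝ) (h : Fin n ⊕ W.Inv → ℝ) (i : W.Inv) :
    (W.dlJac θs *ᵥ h) (Sum.inr i)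
      = (W.Dc i.1 * (W.kronJacI θs *ᵥ fun j => h (Sum.inl j)) i - h (Sum.inr i)
          - ∑ j : W.Inv, W.comm i.1 j.1 * (h (Sum.inr i) / W.Dc i.1 - h (Sum.inr j) / W.Dc j.1))
          / W.kgain i.1 := by
  have hc : (W.commLapI *ᵥ fun j : W.Inv => h (Sum.inr j) / W.Dc j.1) i
      = ∑ j : W.Inv, W.comm i.1 j.1 * (h (Sum.inr i) / W.Dc i.1 - h (Sum.inr j) / W.Dc j.1) :=
    commLapI_mulVec _ i
  rw [← hc]
  simp only [dlJac, Matrix.fromBlocks_mulVec, Sum.elim_inr, Pi.add_apply]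
  simp only [Matrix.mulVec, dotProduct, Function.comp_apply]
  have h1 : ∀ j, W.Dc i.1 * W.kronJacI θs i j / W.kgain i.1 * h (Sum.inl j)
      = (W.kronJacI θs i j * h (Sum.inl j)) * (W.Dc i.1 / W.kgain i.1) := fun j => by ring
  have h2 : ∀ j : W.Inv, -((if i = j then (1 : ℝ) else 0) + W.commLapI i j / W.Dc j.1) / W.kgain i.1
        * h (Sum.inr j)
      = ((if i = j then h (Sum.inr j) else 0) + W.commLapI i j * (h (Sum.inr j) / W.Dc j.1))
          * (-(W.kgain i.1)⁻¹) := fun j => by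
    split_ifs <;> ring
  simp only [h1, h2, ← Finset.sum_mul, Finset.sum_add_distrib, Finset.sum_ite_eq, Finset.mem_univ,
    if_true]
  field_simp
  ring

/-! ### The linearisation is the Jacobian -/

/-- The projection `(θ, p̃) ↦ θ` as a continuous linear map. [folklore] -/
private def projθ : (Fin n ⊕ W.Inv → ℝ) →L[ℝ] (Fin n → ℝ) :=
  ContinuousLinearMap.pi fun j => ContinuousLinearMap.proj (Sum.inl j)

/-- `projθ x = θ`. [folklore] -/
private theorem projθ_apply (x : Fin n ⊕ W.Inv → ℝ) :
    (projθ : (Fin n ⊕ W.Inv → ℝ) →L[ℝ] (Fin n → ℝ)) x = fun j => x (Sum.inl j) := rfl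

/-- Row lemma: inverter rows of `kronJac`. [folklore] -/
private theorem kronJac_mulVec_inv' (θs : Fin n → ℝ) (h : Fin n → ℝ) (i : W.Inv) :
    (W.kronJac θs *ᵥ h) i.1 = (W.kronJacI θs *ᵥ h) i := by
  simp only [Matrix.mulVec, dotProduct, DroopNetwork.kronJac, dif_pos i.2]

/-- A product `g·f` at a zero of `f` is differentiable with derivative `g(x₀)·f'` as soon as `g` is
continuous at `x₀`. [folklore] -/
private theorem hasFDerivAt_mul_of_eq_zero' {E : Type*} [NormedAddCommGroup E] [NormedSpace ℝ E]
    {g f : E → ℝ} {f' : E →L[ℝ] ℝ} {x₀ : E} (hg : ContinuousAt g x₀) (hf : HasFDerivAt f f' x₀)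
    (hf0 : f x₀ = 0) : HasFDerivAt (fun x => g x * f x) (g x₀ • f') x₀ := by
  have hf' := hf
  rw [hasFDerivAt_iff_isLittleO] at hf ⊢
  have h1 : (fun x => g x - g x₀) =o[𝓝 x₀] (fun _ => (1 : ℝ)) := by
    rw [Asymptotics.isLittleO_one_iff]
    have : Tendsto (fun x => g x - g x₀) (𝓝 x₀) (𝓝 (g x₀ - g x₀)) := hg.tendsto.sub_const (g x₀)
    rwa [sub_self] at this
  have h2 : (fun x => f x) =O[𝓝 x₀] (fun x => ‖x - x₀‖) := by
    have := hf'.isBigO_sub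
    simp only [hf0, sub_zero] at this
    exact this.norm_right
  have h3 : (fun x => (g x - g x₀) * f x) =o[𝓝 x₀] (fun x => x - x₀) := by
    have := h1.mul_isBigO h2
    simp only [one_mul] at this
    exact this.of_norm_right
  have h4 : (fun x => g x₀ * (f x - f x₀ - f' (x - x₀))) =o[𝓝 x₀] (fun x => x - x₀) :=
    hf.const_mul_left (g x₀)
  refine (h3.add h4).congr_left fun x => ?_
  simp only [hf0, mul_zero, smul_apply, smul_eq_mul]
  ring

/-- **The linearisation IS the Jacobian**: at `(θ*, 0)`, `θ*` an (Aux)-equilibrium with `L_LL(θ*)`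
invertible, the Kron-extended closed loop has Fréchet derivative `toLin' (dlJac θ*)` (the
elimination matrix `G(θ)` is only continuous at `θ*`; it multiplies `p̃/D`, which vanishes there).
[cite: SimpsonporcoDorflerBullo2013, App. C («we linearize the DAE … about the regular fixed point `(θ*, p̃*)` and eliminate the resulting algebraic equations»)] -/
theorem hasFDerivAt_dlField {θs : Fin n → ℝ} (hθs : W.IsAuxEquilibrium θs)
    (hU : IsUnit (W.lapLL θs).det) :
    HasFDerivAt (W.dlField θs) (LinearMap.toContinuousLinearMap (Matrix.toLin' (W.dlJac θs)))
      (W.lphase θs 0) := by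
  set x₀ : Fin n ⊕ W.Inv → ℝ := W.lphase θs 0 with hx₀
  set K : (Fin n → ℝ) →L[ℝ] (Fin n → ℝ) :=
    LinearMap.toContinuousLinearMap (Matrix.toLin' (W.kronJac θs)) with hKdef
  set P : (Fin n ⊕ W.Inv → ℝ) →L[ℝ] (Fin n → ℝ) := projθ with hPdef
  have hproj : ∀ k : Fin n ⊕ W.Inv, HasFDerivAt (fun x : Fin n ⊕ W.Inv → ℝ => x k)
      (ContinuousLinearMap.proj k : (Fin n ⊕ W.Inv → ℝ) →L[ℝ] ℝ) x₀ := fun k => hasFDerivAt_apply k _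
  have hθ : P x₀ = θs := by
    rw [hPdef, projθ_apply]; funext j; simp [hx₀, lphase]
  have hq0 : ∀ i : W.Inv, x₀ (Sum.inr i) = 0 := fun i => by simp [hx₀, lphase]
  have hg : HasFDerivAt (W.kronField θs) K (P x₀) := by
    rw [hθ]; exact DroopNetwork.hasFDerivAt_kronField (N := W.toDroopNetwork) hθs hU
  have hK : HasFDerivAt (fun x : Fin n ⊕ W.Inv → ℝ => W.kronField θs (P x)) (K.comp P) x₀ :=
    hg.comp x₀ P.hasFDerivAt
  have hKj : ∀ j, HasFDerivAt (fun x : Fin n ⊕ W.Inv → ℝ => W.kronField θs (P x) j)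
      ((ContinuousLinearMap.proj j : (Fin n → ℝ) →L[ℝ] ℝ).comp (K.comp P)) x₀ :=
    fun j => hasFDerivAt_pi'.1 hK j
  have hKj_apply : ∀ j (h : Fin n ⊕ W.Inv → ℝ),
      ((ContinuousLinearMap.proj j : (Fin n → ℝ) →L[ℝ] ℝ).comp (K.comp P)) h
        = (W.kronJac θs *ᵥ fun j' => h (Sum.inl j')) j := by
    intro j h
    simp only [ContinuousLinearMap.comp_apply, hPdef, projθ_apply, hKdef,
      LinearMap.coe_toContinuousLinearMap', Matrix.toLin'_apply, ContinuousLinearMap.proj_apply]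
  -- the `p̃_i/D_i` coordinates
  have hqi : ∀ i : W.Inv, HasFDerivAt (fun x : Fin n ⊕ W.Inv → ℝ => x (Sum.inr i) / W.Dc i.1)
      ((W.Dc i.1)⁻¹ • (ContinuousLinearMap.proj (Sum.inr i) : (Fin n ⊕ W.Inv → ℝ) →L[ℝ] ℝ)) x₀ := by
    intro i
    refine ((hproj (Sum.inr i)).const_mul (W.Dc i.1)⁻¹).congr_of_eventuallyEq
      (Eventually.of_forall fun x => ?_)
    simp only [div_eq_inv_mul]
  -- inverter angle rows as `kronField − p̃/D`
  have hIfun : ∀ i : W.Inv, (fun x : Fin n ⊕ W.Inv → ℝ => W.dlField θs x (Sum.inl i.1))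
      = fun x => W.kronField θs (P x) i.1 - x (Sum.inr i) / W.Dc i.1 := by
    intro i; funext x
    rw [dlField_inl_inv, dlFieldI, hPdef, projθ_apply]
    simp only [DroopNetwork.kronField, dif_pos i.2]
  have hI : ∀ i : W.Inv, HasFDerivAt (fun x : Fin n ⊕ W.Inv → ℝ => W.dlField θs x (Sum.inl i.1))
      (((ContinuousLinearMap.proj i.1 : (Fin n → ℝ) →L[ℝ] ℝ).comp (K.comp P))
        - (W.Dc i.1)⁻¹ • (ContinuousLinearMap.proj (Sum.inr i) : (Fin n ⊕ W.Inv → ℝ) →L[ℝ] ℝ)) x₀ := by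
    intro i
    rw [hIfun i]
    exact (hKj i.1).sub (hqi i)
  rw [hasFDerivAt_pi']
  intro kk
  cases kk with
  | inl j =>
    by_cases hj : 0 < W.Dc j
    · refine (hI ⟨j, hj⟩).congr_fderiv (ContinuousLinearMap.ext fun h => ?_)
      rw [ContinuousLinearMap.comp_apply, LinearMap.coe_toContinuousLinearMap', Matrix.toLin'_apply,
        ContinuousLinearMap.proj_apply]
      have hrow := dlJac_mulVec_inl_inv θs h ⟨j, hj⟩
      rw [hrow, sub_apply, hKj_apply]
      simp only [smul_apply, ContinuousLinearMap.proj_apply, smul_eq_mul, div_eq_inv_mul]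
    · -- load row: `kronField_l(θ) − Σ_i G(θ)_li p̃_i/D_i`
      set l : W.Load := ⟨j, hj⟩ with hl
      have hfun : (fun x : Fin n ⊕ W.Inv → ℝ => W.dlField θs x (Sum.inl j))
          = fun x => W.kronField θs (P x) j
              - ∑ i : W.Inv, W.elim (P x) l i * (x (Sum.inr i) / W.Dc i.1) := by
        funext x
        have h1 := dlField_inl_load θs x l
        rw [hl] at h1
        rw [h1, hPdef, projθ_apply]
        simp only [dlFieldL, dlFieldI, DroopNetwork.kronField, dif_neg hj, DroopNetwork.kronFieldL,
          Pi.add_apply, Matrix.mulVec, dotProduct, mul_sub, Finset.sum_sub_distrib]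
        ring
      rw [hfun]
      have hprod : ∀ i : W.Inv, HasFDerivAt
          (fun x : Fin n ⊕ W.Inv → ℝ => W.elim (P x) l i * (x (Sum.inr i) / W.Dc i.1))
          (W.elim (P x₀) l i • ((W.Dc i.1)⁻¹ •
            (ContinuousLinearMap.proj (Sum.inr i) : (Fin n ⊕ W.Inv → ℝ) →L[ℝ] ℝ))) x₀ := by
        intro i
        have hcont : ContinuousAt (fun x : Fin n ⊕ W.Inv → ℝ => W.elim (P x) l i) x₀ := by
          have h1 : ContinuousAt (fun θ => W.elim θ l i) (P x₀) := by
            rw [hθ]; exact DroopNetwork.continuousAt_elim (N := W.toDroopNetwork) hU l i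
          have h2 : (fun x : Fin n ⊕ W.Inv → ℝ => W.elim (P x) l i) = (fun θ => W.elim θ l i) ∘ P := rfl
          rw [h2]
          exact ContinuousAt.comp h1 P.continuous.continuousAt
        exact hasFDerivAt_mul_of_eq_zero' hcont (hqi i) (by rw [hq0 i, zero_div])
      have h1 := (hKj j).sub (HasFDerivAt.fun_sum (u := Finset.univ) fun (i : W.Inv) _ => hprod i)
      refine h1.congr_fderiv (ContinuousLinearMap.ext fun h => ?_)
      rw [ContinuousLinearMap.comp_apply, LinearMap.coe_toContinuousLinearMap', Matrix.toLin'_apply,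
        ContinuousLinearMap.proj_apply]
      have hrow := dlJac_mulVec_inl_load θs h l
      rw [hl] at hrow
      rw [hrow, sub_apply, hKj_apply, hθ]
      simp only [_root_.sum_apply, smul_apply, ContinuousLinearMap.proj_apply, smul_eq_mul,
        div_eq_inv_mul, hl]
  | inr i =>
    have hterm : ∀ j : W.Inv, HasFDerivAt
        (fun x : Fin n ⊕ W.Inv → ℝ => W.comm i.1 j.1 * (x (Sum.inr i) / W.Dc i.1 - x (Sum.inr j) / W.Dc j.1))
        (W.comm i.1 j.1 • ((W.Dc i.1)⁻¹ •
            (ContinuousLinearMap.proj (Sum.inr i) : (Fin n ⊕ W.Inv → ℝ) →L[ℝ] ℝ)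
          - (W.Dc j.1)⁻¹ • (ContinuousLinearMap.proj (Sum.inr j) : (Fin n ⊕ W.Inv → ℝ) →L[ℝ] ℝ))) x₀ :=
      fun j => ((hqi i).sub (hqi j)).const_mul (W.comm i.1 j.1)
    have hsum : HasFDerivAt
        (fun x : Fin n ⊕ W.Inv → ℝ =>
          ∑ j : W.Inv, W.comm i.1 j.1 * (x (Sum.inr i) / W.Dc i.1 - x (Sum.inr j) / W.Dc j.1))
        (∑ j : W.Inv, W.comm i.1 j.1 • ((W.Dc i.1)⁻¹ •
            (ContinuousLinearMap.proj (Sum.inr i) : (Fin n ⊕ W.Inv → ℝ) →L[ℝ] ℝ)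
          - (W.Dc j.1)⁻¹ • (ContinuousLinearMap.proj (Sum.inr j) : (Fin n ⊕ W.Inv → ℝ) →L[ℝ] ℝ))) x₀ :=
      HasFDerivAt.fun_sum (u := Finset.univ) fun j _ => hterm j
    have hfun : (fun x : Fin n ⊕ W.Inv → ℝ => W.dlField θs x (Sum.inr i))
        = fun x => (W.Dc i.1 * W.dlField θs x (Sum.inl i.1)
            - ∑ j : W.Inv, W.comm i.1 j.1 * (x (Sum.inr i) / W.Dc i.1 - x (Sum.inr j) / W.Dc j.1))
            / W.kgain i.1 := by
      funext x
      rw [dlField_inl_inv]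
      simp only [dlField, Sum.elim_inr, dlFieldP]
    rw [hfun]
    have hF := (((hI i).const_mul (W.Dc i.1)).sub hsum).mul_const (W.kgain i.1)⁻¹
    have hF2 : HasFDerivAt (fun x : Fin n ⊕ W.Inv → ℝ => (W.Dc i.1 * W.dlField θs x (Sum.inl i.1)
        - ∑ j : W.Inv, W.comm i.1 j.1 * (x (Sum.inr i) / W.Dc i.1 - x (Sum.inr j) / W.Dc j.1))
          / W.kgain i.1) _ x₀ :=
      hF.congr_of_eventuallyEq (Eventually.of_forall fun x => by
        simp only [Pi.sub_apply, div_eq_mul_inv])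
    refine hF2.congr_fderiv (ContinuousLinearMap.ext fun h => ?_)
    rw [ContinuousLinearMap.comp_apply, LinearMap.coe_toContinuousLinearMap', Matrix.toLin'_apply,
      ContinuousLinearMap.proj_apply, dlJac_mulVec_inr, ← kronJac_mulVec_inv']
    simp only [smul_apply, sub_apply, _root_.sum_apply, ContinuousLinearMap.proj_apply, smul_eq_mul,
      hKj_apply, div_eq_inv_mul]
    have hDi : W.Dc i.1 ≠ 0 := i.2.ne'
    field_simp

/-! ## §2 The spectrum of `dlJac θ*`: left half-plane except the rotation mode -/

/-- Entries of the inverter rows of `kronJac`. [folklore] -/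
private theorem kronJacI_apply' (θs : Fin n → ℝ) (i : W.Inv) (j : Fin n) :
    W.kronJacI θs i j = -(W.Dc i.1)⁻¹ * (W.lap θs i.1 j
      - ∑ l : W.Load, (W.lapIL θs * (W.lapLL θs)⁻¹) i l * W.lap θs l.1 j) := by
  rw [DroopNetwork.kronJacI, Matrix.diagonal_mul]
  simp only [Matrix.sub_apply, Matrix.mul_apply, DroopNetwork.lapI, DroopNetwork.lapL]

/-- Entries of the load rows of `kronJac`. [folklore] -/
private theorem kronJacL_apply' (θs : Fin n → ℝ) (l : W.Load) (j : Fin n) :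
    W.kronJacL θs l j = ∑ i : W.Inv, W.elim θs l i * W.kronJacI θs i j
      - ∑ l' : W.Load, (W.lapLL θs)⁻¹ l l' * W.lap θs l'.1 j := by
  simp only [DroopNetwork.kronJacL, Matrix.sub_apply, Matrix.mul_apply, DroopNetwork.lapL]

/-- A row identity used to complexify the inverter rows. [folklore] -/
private theorem sum_row_identity' {ι κ R : Type*} [Fintype ι] [Fintype κ] [CommRing R]
    (c : R) (a v : ι → R) (C : κ → R) (b : κ → ι → R) :
    ∑ x, (c * (a x - ∑ l, C l * b l x)) * v x
      = c * (∑ x, a x * v x - ∑ l, C l * ∑ x, b l x * v x) := by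
  simp only [sub_mul, mul_sub, Finset.sum_sub_distrib, Finset.mul_sum, Finset.sum_mul]
  congr 1
  · exact Finset.sum_congr rfl fun x _ => by ring
  · rw [Finset.sum_comm]
    exact Finset.sum_congr rfl fun l _ => Finset.sum_congr rfl fun x _ => by ring

/-- Inverter row of the complexified `kronJac`: `−D_i⁻¹((Lv)_i − Σ_l (L_IL L_LL⁻¹)_{il}(Lv)_l)`. [folklore] -/
private theorem kronJac_map_mulVec_inv' (θs : Fin n → ℝ) (v : Fin n → ℂ) (i : W.Inv) :
    (((W.kronJac θs).map ((↑) : ℝ → ℂ)) *ᵥ v) i.1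
      = -((W.Dc i.1 : ℝ) : ℂ)⁻¹ * ((((W.lap θs).map ((↑) : ℝ → ℂ)) *ᵥ v) i.1
        - ∑ l : W.Load, ((W.lapIL θs * (W.lapLL θs)⁻¹) i l : ℂ)
          * (((W.lap θs).map ((↑) : ℝ → ℂ)) *ᵥ v) l.1) := by
  simp only [Matrix.mulVec, dotProduct, Matrix.map_apply, DroopNetwork.kronJac, dif_pos i.2,
    Subtype.coe_eta, kronJacI_apply']
  push_cast
  exact sum_row_identity' _ _ _ _ _

/-- The inverter-row sum `Σ_j J_I,ij v_j` equals the complexified `kronJac` row. [folklore] -/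
private theorem kronJacI_map_sum (θs : Fin n → ℝ) (v : Fin n → ℂ) (i : W.Inv) :
    ∑ j, (W.kronJacI θs i j : ℂ) * v j = (((W.kronJac θs).map ((↑) : ℝ → ℂ)) *ᵥ v) i.1 := by
  simp only [Matrix.mulVec, dotProduct, Matrix.map_apply, DroopNetwork.kronJac, dif_pos i.2,
    Subtype.coe_eta]

/-- Load row of the complexified `kronJac`: `Σ_i G_{li}(Jv)_i − Σ_l' (L_LL⁻¹)_{ll'}(Lv)_l'`. [folklore] -/
private theorem kronJac_map_mulVec_load' (θs : Fin n → ℝ) (v : Fin n → ℂ) (l : W.Load) :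
    (((W.kronJac θs).map ((↑) : ℝ → ℂ)) *ᵥ v) l.1
      = ∑ i : W.Inv, (W.elim θs l i : ℂ) * (((W.kronJac θs).map ((↑) : ℝ → ℂ)) *ᵥ v) i.1
        - ∑ l' : W.Load, ((W.lapLL θs)⁻¹ l l' : ℂ) * (((W.lap θs).map ((↑) : ℝ → ℂ)) *ᵥ v) l'.1 := by
  simp only [← kronJacI_map_sum]
  simp only [Matrix.mulVec, dotProduct, Matrix.map_apply, DroopNetwork.kronJac, dif_neg l.2,
    kronJacL_apply']
  push_cast
  simp only [sub_mul, Finset.sum_sub_distrib, Finset.sum_mul, Finset.mul_sum]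
  congr 1
  · rw [Finset.sum_comm]
    exact Finset.sum_congr rfl fun i _ => Finset.sum_congr rfl fun j _ => by ring
  · rw [Finset.sum_comm]
    exact Finset.sum_congr rfl fun l' _ => Finset.sum_congr rfl fun j _ => by ring

/-- The complexified Laplacian row: `(L v)_j = Σ_j' ℓ_jj' (v_j − v_j')`. [folklore] -/
private theorem lap_map_mulVec_eq' (θs : Fin n → ℝ) (v : Fin n → ℂ) (j : Fin n) :
    (((W.lap θs).map ((↑) : ℝ → ℂ)) *ᵥ v) j = ∑ j', (W.linWeight θs j j' : ℂ) * (v j - v j') := by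
  have hentry : ∀ j', ((W.lap θs).map ((↑) : ℝ → ℂ)) j j'
      = (if j = j' then ∑ k, (W.linWeight θs j k : ℂ) else 0) - (W.linWeight θs j j' : ℂ) := by
    intro j'
    simp only [Matrix.map_apply, DroopNetwork.lap]
    split_ifs <;> push_cast <;> ring
  simp only [Matrix.mulVec, dotProduct, hentry, sub_mul, Finset.sum_sub_distrib, ite_mul, zero_mul,
    Finset.sum_ite_eq, Finset.mem_univ, if_true, mul_sub, Finset.sum_mul]

/-- The load part of `Lv` through the blocks: `(Lv)_l = Σ_l' L_LL,ll' v_l' + Σ_i L_LI,li v_i`. [folklore] -/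
private theorem lap_map_mulVec_load' (θs : Fin n → ℝ) (v : Fin n → ℂ) (l : W.Load) :
    (((W.lap θs).map ((↑) : ℝ → ℂ)) *ᵥ v) l.1
      = ∑ l' : W.Load, (W.lapLL θs l l' : ℂ) * v l'.1 + ∑ i : W.Inv, (W.lapLI θs l i : ℂ) * v i.1 := by
  simp only [Matrix.mulVec, dotProduct, Matrix.map_apply, DroopNetwork.lapLL, DroopNetwork.lapLI]
  rw [sum_split' (W := W), add_comm]

/-- Inverter angle row of the complexified Jacobian. [cite: SimpsonporcoDorflerBullo2013, App. C] -/
theorem dlJac_map_mulVec_inl_inv (θs : Fin n → ℝ) (x : Fin n ⊕ W.Inv → ℂ) (i : W.Inv) :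
    (((W.dlJac θs).map ((↑) : ℝ → ℂ)) *ᵥ x) (Sum.inl i.1)
      = (((W.kronJac θs).map ((↑) : ℝ → ℂ)) *ᵥ fun j => x (Sum.inl j)) i.1
        - x (Sum.inr i) / (W.Dc i.1 : ℂ) := by
  rw [dlJac, Matrix.fromBlocks_map, Matrix.fromBlocks_mulVec]
  simp only [Sum.elim_inl, Pi.add_apply]
  simp only [Matrix.mulVec, dotProduct, Matrix.map_apply, Function.comp_apply, dif_pos i.2,
    Subtype.coe_eta]
  have h1 : ∀ i' : W.Inv, (((if i = i' then -(W.Dc i.1)⁻¹ else 0 : ℝ) : ℂ)) * x (Sum.inr i')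
      = if i = i' then -((W.Dc i.1 : ℂ))⁻¹ * x (Sum.inr i') else 0 := by
    intro i'
    split_ifs <;> push_cast <;> ring
  simp only [h1, Finset.sum_ite_eq, Finset.mem_univ, if_true]
  rw [div_eq_mul_inv]
  ring

/-- Load angle row of the complexified Jacobian. [cite: SimpsonporcoDorflerBullo2013, App. C] -/
theorem dlJac_map_mulVec_inl_load (θs : Fin n → ℝ) (x : Fin n ⊕ W.Inv → ℂ) (l : W.Load) :
    (((W.dlJac θs).map ((↑) : ℝ → ℂ)) *ᵥ x) (Sum.inl l.1)
      = (((W.kronJac θs).map ((↑) : ℝ → ℂ)) *ᵥ fun j => x (Sum.inl j)) l.1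
        - ∑ i : W.Inv, (W.elim θs l i : ℂ) * (x (Sum.inr i) / (W.Dc i.1 : ℂ)) := by
  rw [dlJac, Matrix.fromBlocks_map, Matrix.fromBlocks_mulVec]
  simp only [Sum.elim_inl, Pi.add_apply]
  rw [sub_eq_add_neg]
  congr 1
  simp only [Matrix.mulVec, dotProduct, Matrix.map_apply, Function.comp_apply, dif_neg l.2,
    Subtype.coe_eta]
  rw [← Finset.sum_neg_distrib]
  refine Finset.sum_congr rfl fun i _ => ?_
  push_cast
  ring

/-- Secondary row of the complexified Jacobian. [cite: SimpsonporcoDorflerBullo2013, App. C] -/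
theorem dlJac_map_mulVec_inr (θs : Fin n → ℝ) (x : Fin n ⊕ W.Inv → ℂ) (i : W.Inv) :
    (((W.dlJac θs).map ((↑) : ℝ → ℂ)) *ᵥ x) (Sum.inr i)
      = ((W.Dc i.1 : ℂ) * (((W.kronJac θs).map ((↑) : ℝ → ℂ)) *ᵥ fun j => x (Sum.inl j)) i.1
          - x (Sum.inr i)
          - ∑ j : W.Inv, (W.comm i.1 j.1 : ℂ)
              * (x (Sum.inr i) / (W.Dc i.1 : ℂ) - x (Sum.inr j) / (W.Dc j.1 : ℂ))) / (W.kgain i.1 : ℂ) := by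
  rw [dlJac, Matrix.fromBlocks_map, Matrix.fromBlocks_mulVec]
  simp only [Sum.elim_inr, Pi.add_apply, ← kronJacI_map_sum]
  have hc : ∑ j : W.Inv, (W.comm i.1 j.1 : ℂ) * (x (Sum.inr i) / (W.Dc i.1 : ℂ) - x (Sum.inr j) / (W.Dc j.1 : ℂ))
      = ∑ j : W.Inv, (W.commLapI i j : ℂ) * (x (Sum.inr j) / (W.Dc j.1 : ℂ)) := by
    have hentry : ∀ j : W.Inv, (W.commLapI i j : ℂ)
        = (if i = j then ∑ k : W.Inv, (W.comm i.1 k.1 : ℂ) else 0) - (W.comm i.1 j.1 : ℂ) := by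
      intro j
      simp only [commLapI]
      split_ifs <;> push_cast <;> ring
    simp only [hentry, sub_mul, Finset.sum_sub_distrib, ite_mul, zero_mul, Finset.sum_ite_eq,
      Finset.mem_univ, if_true, mul_sub, Finset.sum_mul]
  rw [hc]
  simp only [Matrix.mulVec, dotProduct, Matrix.map_apply, Function.comp_apply]
  have h1 : ∀ j, ((W.Dc i.1 * W.kronJacI θs i j / W.kgain i.1 : ℝ) : ℂ) * x (Sum.inl j)
      = ((W.kronJacI θs i j : ℂ) * x (Sum.inl j)) * ((W.Dc i.1 : ℂ) / (W.kgain i.1 : ℂ)) := by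
    intro j; push_cast; ring
  have h2 : ∀ j : W.Inv,
      ((-((if i = j then (1 : ℝ) else 0) + W.commLapI i j / W.Dc j.1) / W.kgain i.1 : ℝ) : ℂ) * x (Sum.inr j)
      = ((if i = j then x (Sum.inr j) else 0) + (W.commLapI i j : ℂ) * (x (Sum.inr j) / (W.Dc j.1 : ℂ)))
          * (-((W.kgain i.1 : ℂ))⁻¹) := by
    intro j
    split_ifs <;> push_cast <;> ring
  simp only [h1, h2, ← Finset.sum_mul, Finset.sum_add_distrib, Finset.sum_ite_eq, Finset.mem_univ,
    if_true]
  rw [div_eq_mul_inv, div_eq_mul_inv]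
  ring

/-! ### Laplacian forms over `ℂ` (index-generic copies of the companions' private algebra) -/

/-- The real part of the complex Laplacian form splits into the real forms of the real and imaginary
parts. [folklore] -/
private theorem re_conj_lapForm' {ι : Type*} [Fintype ι] (c : ι → ι → ℝ) (v : ι → ℂ) :
    (∑ i, conj (v i) * ∑ j, (c i j : ℂ) * (v i - v j)).re
      = (∑ i, (v i).re * ∑ j, c i j * ((v i).re - (v j).re))
        + ∑ i, (v i).im * ∑ j, c i j * ((v i).im - (v j).im) := by
  rw [Complex.re_sum, ← Finset.sum_add_distrib]
  refine Finset.sum_congr rfl fun i _ => ?_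
  rw [Finset.mul_sum, Finset.mul_sum, Finset.mul_sum, Complex.re_sum, ← Finset.sum_add_distrib]
  refine Finset.sum_congr rfl fun j _ => ?_
  simp only [Complex.mul_re, Complex.mul_im, Complex.conj_re, Complex.conj_im, Complex.sub_re,
    Complex.sub_im, Complex.ofReal_re, Complex.ofReal_im, zero_mul, sub_zero, add_zero]
  ring

/-- `2 Σ_i conj(v_i) Σ_j c_ij (v_i − v_j) = Σ_i Σ_j c_ij |v_i − v_j|²` (symmetric `c`). [folklore] -/
private theorem conj_lapForm_eq'' {ι : Type*} [Fintype ι] {c : ι → ι → ℝ}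
    (hc : ∀ i j, c i j = c j i) (v : ι → ℂ) :
    2 * ∑ i, conj (v i) * ∑ j, (c i j : ℂ) * (v i - v j)
      = ((∑ i, ∑ j, c i j * ‖v i - v j‖ ^ 2 : ℝ) : ℂ) := by
  have hS : ∑ i, conj (v i) * ∑ j, (c i j : ℂ) * (v i - v j)
      = ∑ i, ∑ j, (c i j : ℂ) * (conj (v i) * (v i - v j)) := by
    refine Finset.sum_congr rfl fun i _ => ?_
    rw [Finset.mul_sum]
    refine Finset.sum_congr rfl fun j _ => ?_
    ring
  have hS' : ∑ i, ∑ j, (c i j : ℂ) * (conj (v i) * (v i - v j))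
      = ∑ i, ∑ j, (c i j : ℂ) * (conj (v j) * (v j - v i)) := by
    rw [Finset.sum_comm]
    refine Finset.sum_congr rfl fun i _ => Finset.sum_congr rfl fun j _ => ?_
    rw [hc j i]
  rw [two_mul, hS]
  conv_lhs => arg 2; rw [hS']
  push_cast
  rw [← Finset.sum_add_distrib]
  refine Finset.sum_congr rfl fun i _ => ?_
  rw [← Finset.sum_add_distrib]
  refine Finset.sum_congr rfl fun j _ => ?_
  rw [← Complex.conj_mul' (v i - v j), map_sub]
  ring

/-- A complex Laplacian form with a real PSD + kernel certificate is a nonnegative real, and it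
vanishes only on constant vectors. [folklore] -/
private theorem lapForm_real_of_psd'' {ι : Type*} [Fintype ι] {c : ι → ι → ℝ}
    (hc : ∀ i j, c i j = c j i)
    (hpsd : ∀ u : ι → ℝ, 0 ≤ ∑ i, u i * ∑ j, c i j * (u i - u j))
    (hker : ∀ u : ι → ℝ, ∑ i, u i * ∑ j, c i j * (u i - u j) = 0 → ∃ a : ℝ, u = fun _ => a)
    (v : ι → ℂ) :
    ∃ r : ℝ, 0 ≤ r ∧ (∑ i, conj (v i) * ∑ j, (c i j : ℂ) * (v i - v j)) = (r : ℂ) ∧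
      (r = 0 → ∃ a : ℂ, v = fun _ => a) := by
  obtain ⟨R, hR⟩ : ∃ R : ℂ, R = ∑ i, conj (v i) * ∑ j, (c i j : ℂ) * (v i - v j) := ⟨_, rfl⟩
  obtain ⟨Q, hQ⟩ : ∃ Q : ℝ, Q = ∑ i, ∑ j, c i j * ‖v i - v j‖ ^ 2 := ⟨_, rfl⟩
  obtain ⟨fr, hfr⟩ : ∃ fr : ℝ, fr = ∑ i, (v i).re * ∑ j, c i j * ((v i).re - (v j).re) := ⟨_, rfl⟩
  obtain ⟨fi, hfi⟩ : ∃ fi : ℝ, fi = ∑ i, (v i).im * ∑ j, c i j * ((v i).im - (v j).im) := ⟨_, rfl⟩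
  have hRQ : 2 * R = (Q : ℂ) := by rw [hR, hQ]; exact conj_lapForm_eq'' hc v
  have hRre : R.re = fr + fi := by rw [hR, hfr, hfi]; exact re_conj_lapForm' c v
  have hRim : R.im = 0 := by
    have h := congrArg Complex.im hRQ
    simp only [Complex.mul_im, Complex.ofReal_im] at h
    norm_num at h
    exact h
  have hfr0 : 0 ≤ fr := by rw [hfr]; exact hpsd _
  have hfi0 : 0 ≤ fi := by rw [hfi]; exact hpsd _
  refine ⟨fr + fi, by positivity, ?_, fun h0 => ?_⟩
  · rw [← hR]
    exact Complex.ext (by simp [hRre]) (by simp [hRim])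
  · have hfr00 : fr = 0 := by linarith
    have hfi00 : fi = 0 := by linarith
    obtain ⟨ar, har⟩ := hker _ (hfr ▸ hfr00)
    obtain ⟨ai, hai⟩ := hker _ (hfi ▸ hfi00)
    refine ⟨⟨ar, ai⟩, funext fun i => Complex.ext ?_ ?_⟩
    · simpa using congrFun har i
    · simpa using congrFun hai i

/-- `Σ_i Σ_j c_ij (v_i − v_j) = 0` for symmetric `c`. [folklore] -/
private theorem sum_lapRow_eq_zero' {ι : Type*} [Fintype ι] {c : ι → ι → ℝ}
    (hc : ∀ i j, c i j = c j i) (v : ι → ℂ) : ∑ i, ∑ j, (c i j : ℂ) * (v i - v j) = 0 := by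
  have hswap : ∑ i, ∑ j, (c i j : ℂ) * (v i - v j) = ∑ i, ∑ j, (c j i : ℂ) * (v j - v i) :=
    Finset.sum_comm
  have hneg : ∑ i, ∑ j, (c j i : ℂ) * (v j - v i) = -∑ i, ∑ j, (c i j : ℂ) * (v i - v j) := by
    rw [← Finset.sum_neg_distrib]
    refine Finset.sum_congr rfl fun i _ => ?_
    rw [← Finset.sum_neg_distrib]
    refine Finset.sum_congr rfl fun j _ => ?_
    rw [hc j i]; ring
  have h2 : (2 : ℂ) * ∑ i, ∑ j, (c i j : ℂ) * (v i - v j) = 0 := by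
    linear_combination hswap + hneg
  exact (mul_eq_zero.1 h2).resolve_left two_ne_zero

/-- `conj a (a/D + b) + conj b (a + D b) = |a + D b|²/D` for real `D ≠ 0`. [folklore] -/
private theorem pair_form_eq' {D : ℝ} (hD : D ≠ 0) (a b : ℂ) :
    conj a * (a / (D : ℂ) + b) + conj b * (a + (D : ℂ) * b)
      = ((‖a + (D : ℂ) * b‖ ^ 2 / D : ℝ) : ℂ) := by
  have hDC : (D : ℂ) ≠ 0 := by exact_mod_cast hD
  have key : ((‖a + (D : ℂ) * b‖ : ℂ) ^ 2) = conj (a + (D : ℂ) * b) * (a + (D : ℂ) * b) := by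
    rw [Complex.conj_mul']
  push_cast
  rw [key, map_add, map_mul, Complex.conj_ofReal]
  field_simp

/-! ### The spectral sentence -/

/-- **The spectral lemma of the DAPI closed loop WITH LOAD NODES, PROVED** (replacing the printed
continuity argument in `ε`).  Hypotheses: `D_i ≥ 0` with inverters `V_I = {D_i > 0}`, at least one
inverter `i₀`, `k_i > 0`, `|Y|` symmetric, symmetric communication weights among the inverters, and
real PSD + kernel certificates for BOTH Laplacian forms — the linearised network
`u ↦ Σ_i u_i Σ_j a_ij cos(θ*_i − θ*_j)(u_i − u_j)` on ALL nodes and the communication form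
`u ↦ Σ_{V_I} u_i Σ_{V_I} c_ij(u_i − u_j)` on the inverters are `≥ 0` with kernel the constants.  Then
every complex eigenpair `(μ, (v, q))` of `dlJac θ*` has `Re μ < 0`, or `μ = 0` with `(v, q)` a
complex multiple of the rotation mode `(𝟙, 0)`.  Mechanism: the load rows read `(1 + μ)y = 0` for
`y = v_L − G(θ*)v_I`, so either `μ = −1` (off the linearised constraint) or `y = 0`, `(L(θ*)v)_L = 0`,
and then with `w = ((L(θ*)v)_I, D_I⁻¹q)` the printed structure `X₁ ⪰ 0`, `X₂Z⁻¹ = blkdiag(L_red,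
D_I⁻¹K⁻¹)` gives the Hermitian identity `⟨w, X₁w⟩ = −μ(v^*L(θ*)v + Σ k_iD_i|w₂,i|²)` — «`X₂v` is
never in the kernel of `X₁`» excludes `Re μ = 0` off the rotation.
[cite: SimpsonporcoDorflerBullo2013, App. C (proof of Theorem 8 with `V_L ≠ ∅`: `J = −Z⁻¹X₁X₂`, `X₂ = blkdiag(L_red(θ*), D_I⁻¹)`, kernels of `X₁`, `X₂`, «all eigenvalues are real and negative» modulo rotational symmetry)] -/
theorem dlJac_eig_re_neg_or_rotation (hk : ∀ i : W.Inv, 0 < W.kgain i.1)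
    (hY : ∀ i j, W.Yabs i j = W.Yabs j i) (hcs : ∀ i j : W.Inv, W.comm i.1 j.1 = W.comm j.1 i.1)
    {θs : Fin n → ℝ}
    (hpsd : ∀ u : Fin n → ℝ, 0 ≤ ∑ i, u i * ∑ j, W.linWeight θs i j * (u i - u j))
    (hker : ∀ u : Fin n → ℝ, ∑ i, u i * ∑ j, W.linWeight θs i j * (u i - u j) = 0 →
      ∃ a : ℝ, u = fun _ => a)
    (hcpsd : ∀ u : W.Inv → ℝ, 0 ≤ ∑ i, u i * ∑ j, W.comm i.1 j.1 * (u i - u j))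
    (hcker : ∀ u : W.Inv → ℝ, ∑ i, u i * ∑ j, W.comm i.1 j.1 * (u i - u j) = 0 →
      ∃ a : ℝ, u = fun _ => a)
    (i₀ : W.Inv) {μ : ℂ} {x : Fin n ⊕ W.Inv → ℂ} (hx : x ≠ 0)
    (hJ : (W.dlJac θs).map ((↑) : ℝ → ℂ) *ᵥ x = μ • x) :
    μ.re < 0 ∨ (μ = 0 ∧ ∃ a : ℂ, x = fun kk => a * (W.dlRot kk : ℂ)) := by
  classical
  have hU : IsUnit (W.lapLL θs).det := DroopNetwork.isUnit_lapLL_det (N := W.toDroopNetwork) hker i₀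
  have hℓs : ∀ i j, W.linWeight θs i j = W.linWeight θs j i :=
    DroopNetwork.linWeight_symm (N := W.toDroopNetwork) hY θs
  -- components: angles `v`, secondary variables `q`; `u = L(θ*)v`, `G`, `w = Gv_I`, `y = v_L − w`
  set v : Fin n → ℂ := fun j => x (Sum.inl j) with hv
  set q : W.Inv → ℂ := fun i => x (Sum.inr i) with hq
  set u : Fin n → ℂ := ((W.lap θs).map ((↑) : ℝ → ℂ)) *ᵥ v with hu
  set G : Matrix W.Load W.Inv ℝ := W.elim θs with hG
  set wL : W.Load → ℂ := fun l => ∑ i : W.Inv, (G l i : ℂ) * v i.1 with hwL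
  set y : W.Load → ℂ := fun l => v l.1 - wL l with hy
  have hDC : ∀ i : W.Inv, ((W.Dc i.1 : ℝ) : ℂ) ≠ 0 := fun i => by exact_mod_cast i.2.ne'
  have hkC : ∀ i : W.Inv, ((W.kgain i.1 : ℝ) : ℂ) ≠ 0 := fun i => by exact_mod_cast (hk i).ne'
  -- complexified block identities of the Kron elimination
  have hLG : ∀ (l : W.Load) (i : W.Inv),
      (W.lapLI θs l i : ℂ) = -∑ l' : W.Load, (W.lapLL θs l l' : ℂ) * (G l' i : ℂ) := by
    intro l i
    have h := congrFun (congrFun (DroopNetwork.lapLL_mul_elim (N := W.toDroopNetwork) hU) l) i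
    simp only [Matrix.mul_apply, Matrix.neg_apply] at h
    have h' : W.lapLI θs l i = -∑ l', W.lapLL θs l l' * W.elim θs l' i := by linarith
    rw [h', hG]; push_cast; rfl
  have hinvL : ∀ l l'' : W.Load,
      ∑ l' : W.Load, ((W.lapLL θs)⁻¹ l l' : ℂ) * (W.lapLL θs l' l'' : ℂ) = if l = l'' then 1 else 0 := by
    intro l l''
    have h := congrFun (congrFun (Matrix.nonsing_inv_mul _ hU) l) l''
    simp only [Matrix.mul_apply, Matrix.one_apply] at h
    have h' : ((∑ l', (W.lapLL θs)⁻¹ l l' * W.lapLL θs l' l'' : ℝ) : ℂ)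
        = ((if l = l'' then 1 else 0 : ℝ) : ℂ) := by rw [h]
    push_cast at h'
    rw [h']
    split_ifs <;> simp
  -- (K1) `u_l = Σ_l' L_LL,ll' y_l'`
  have hK1 : ∀ l : W.Load, u l.1 = ∑ l' : W.Load, (W.lapLL θs l l' : ℂ) * y l' := by
    intro l
    rw [hu, lap_map_mulVec_load']
    simp only [hy, hwL, mul_sub, Finset.sum_sub_distrib, hLG, neg_mul, Finset.sum_neg_distrib]
    rw [← sub_eq_add_neg]
    congr 1
    simp only [Finset.sum_mul, Finset.mul_sum]
    rw [Finset.sum_comm]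
    exact Finset.sum_congr rfl fun _ _ => Finset.sum_congr rfl fun _ _ => by ring
  -- (K2) `Σ_l' (L_LL⁻¹)_ll' u_l' = y_l`
  have hK2 : ∀ l : W.Load, ∑ l' : W.Load, ((W.lapLL θs)⁻¹ l l' : ℂ) * u l'.1 = y l := by
    intro l
    simp only [hK1, Finset.mul_sum]
    rw [Finset.sum_comm]
    have : ∀ l'' : W.Load, ∑ l', ((W.lapLL θs)⁻¹ l l' : ℂ) * ((W.lapLL θs l' l'' : ℂ) * y l'')
        = (if l = l'' then 1 else 0) * y l'' := by
      intro l''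
      rw [← hinvL l l'', Finset.sum_mul]
      exact Finset.sum_congr rfl fun l' _ => by ring
    simp only [this, ite_mul, one_mul, zero_mul, Finset.sum_ite_eq, Finset.mem_univ, if_true]
  -- the rows of the eigen-equation
  have hEinv : ∀ i : W.Inv, (((W.kronJac θs).map ((↑) : ℝ → ℂ)) *ᵥ v) i.1 - q i / (W.Dc i.1 : ℂ)
      = μ * v i.1 := by
    intro i
    have h := congrFun hJ (Sum.inl i.1)
    rw [dlJac_map_mulVec_inl_inv] at h
    simpa [hv, hq] using h
  have hEload : ∀ l : W.Load, (((W.kronJac θs).map ((↑) : ℝ → ℂ)) *ᵥ v) l.1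
      - ∑ i : W.Inv, (W.elim θs l i : ℂ) * (q i / (W.Dc i.1 : ℂ)) = μ * v l.1 := by
    intro l
    have h := congrFun hJ (Sum.inl l.1)
    rw [dlJac_map_mulVec_inl_load] at h
    simpa [hv, hq] using h
  have hEp : ∀ i : W.Inv, ((W.Dc i.1 : ℂ) * (((W.kronJac θs).map ((↑) : ℝ → ℂ)) *ᵥ v) i.1 - q i
      - ∑ j : W.Inv, (W.comm i.1 j.1 : ℂ) * (q i / (W.Dc i.1 : ℂ) - q j / (W.Dc j.1 : ℂ)))
        / (W.kgain i.1 : ℂ) = μ * q i := by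
    intro i
    have h := congrFun hJ (Sum.inr i)
    rw [dlJac_map_mulVec_inr] at h
    simpa [hv, hq] using h
  -- the load rows: `(1 + μ) y_l = 0`
  have hyμ : ∀ l : W.Load, (1 + μ) * y l = 0 := by
    intro l
    have h := hEload l
    rw [kronJac_map_mulVec_load', ← hu] at h
    simp only [hK2] at h
    -- `Σ_i G_li ((Jv)_i − q_i/D_i) = μ w_l`
    have hGμ : ∑ i : W.Inv, (G l i : ℂ) * (((W.kronJac θs).map ((↑) : ℝ → ℂ)) *ᵥ v) i.1
        - ∑ i : W.Inv, (W.elim θs l i : ℂ) * (q i / (W.Dc i.1 : ℂ)) = μ * wL l := by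
      rw [hG, ← Finset.sum_sub_distrib]
      simp only [← mul_sub, hEinv, hwL, Finset.mul_sum, hG]
      exact Finset.sum_congr rfl fun i _ => by ring
    simp only [hy] at h ⊢
    linear_combination -h + hGμ
  by_cases hyz : ∃ l : W.Load, y l ≠ 0
  · -- off the linearised constraint: `μ = −1`
    obtain ⟨l, hl⟩ := hyz
    have : 1 + μ = 0 := (mul_eq_zero.1 (hyμ l)).resolve_right hl
    left
    have hμ : μ = -1 := by linear_combination this
    rw [hμ]; norm_num
  · push Not at hyz
    -- on the constraint: `u_L = 0`; with `w₁ = u_I`, `w₂ = q/D_I` the two printed block rows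
    have huL : ∀ l : W.Load, u l.1 = 0 := fun l => by
      rw [hK1 l]; exact Finset.sum_eq_zero fun l' _ => by rw [hyz l', mul_zero]
    set w₂ : W.Inv → ℂ := fun i => q i / (W.Dc i.1 : ℂ) with hw₂
    have hqw : ∀ i : W.Inv, q i = (W.Dc i.1 : ℂ) * w₂ i := fun i => by
      simp only [hw₂]; field_simp [hDC i]
    have hJkron : ∀ i : W.Inv, (((W.kronJac θs).map ((↑) : ℝ → ℂ)) *ᵥ v) i.1
        = -u i.1 / (W.Dc i.1 : ℂ) := by
      intro i
      rw [kronJac_map_mulVec_inv', ← hu]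
      simp only [huL, mul_zero, Finset.sum_const_zero, sub_zero]
      rw [div_eq_mul_inv]; ring
    have hE1 : ∀ i : W.Inv, u i.1 / (W.Dc i.1 : ℂ) + w₂ i = -μ * v i.1 := by
      intro i
      have h := hEinv i
      rw [hJkron i] at h
      simp only [hw₂]
      linear_combination -h
    have hE2 : ∀ i : W.Inv, u i.1 + (W.Dc i.1 : ℂ) * w₂ i
        + ∑ j : W.Inv, (W.comm i.1 j.1 : ℂ) * (w₂ i - w₂ j)
        = -μ * (W.kgain i.1 : ℂ) * ((W.Dc i.1 : ℂ) * w₂ i) := by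
      intro i
      have h := hEp i
      rw [hJkron i, div_eq_iff (hkC i)] at h
      rw [← hqw i]
      have h1 : (W.Dc i.1 : ℂ) * (-u i.1 / (W.Dc i.1 : ℂ)) = -u i.1 := by field_simp [hDC i]
      rw [h1] at h
      have hsum : ∑ j : W.Inv, (W.comm i.1 j.1 : ℂ) * (w₂ i - w₂ j)
          = ∑ j : W.Inv, (W.comm i.1 j.1 : ℂ) * (q i / (W.Dc i.1 : ℂ) - q j / (W.Dc j.1 : ℂ)) := by
        simp only [hw₂]
      rw [hsum]
      linear_combination -h
    -- the full Laplacian form equals the inverter part `Σ_{V_I} conj(v_i) u_i` (`u_L = 0`)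
    obtain ⟨rl, hrl0, hRl, hrl_ker⟩ := lapForm_real_of_psd'' hℓs hpsd hker v
    obtain ⟨rc, hrc0, hRc, hrc_ker⟩ := lapForm_real_of_psd'' hcs hcpsd hcker w₂
    have hRlI : ∑ i : W.Inv, conj (v i.1) * u i.1 = (rl : ℂ) := by
      rw [← hRl]
      have h1 : ∑ j, conj (v j) * ∑ j', (W.linWeight θs j j' : ℂ) * (v j - v j')
          = ∑ j, conj (v j) * u j := Finset.sum_congr rfl fun j _ => by rw [hu, lap_map_mulVec_eq']
      rw [h1, sum_split' (W := W) (fun j => conj (v j) * u j)]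
      simp only [huL, mul_zero, Finset.sum_const_zero, add_zero]
    obtain ⟨P, hP⟩ : ∃ P : ℝ, P = ∑ i : W.Inv, ‖u i.1 + (W.Dc i.1 : ℂ) * w₂ i‖ ^ 2 / W.Dc i.1 :=
      ⟨_, rfl⟩
    obtain ⟨Nw, hNw⟩ : ∃ Nw : ℝ, Nw = ∑ i : W.Inv, W.kgain i.1 * W.Dc i.1 * ‖w₂ i‖ ^ 2 := ⟨_, rfl⟩
    have hP0 : 0 ≤ P := by
      rw [hP]; exact Finset.sum_nonneg fun i _ => div_nonneg (sq_nonneg _) i.2.le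
    have hNw0 : 0 ≤ Nw := by
      rw [hNw]; exact Finset.sum_nonneg fun i _ => by
        have := hk i; have := i.2; positivity
    have hleft : ∑ i : W.Inv, (conj (u i.1) * (u i.1 / (W.Dc i.1 : ℂ) + w₂ i)
        + conj (w₂ i) * (u i.1 + (W.Dc i.1 : ℂ) * w₂ i + ∑ j : W.Inv, (W.comm i.1 j.1 : ℂ) * (w₂ i - w₂ j)))
        = (P : ℂ) + (rc : ℂ) := by
      have hsplit : ∀ i : W.Inv, conj (u i.1) * (u i.1 / (W.Dc i.1 : ℂ) + w₂ i)
          + conj (w₂ i) * (u i.1 + (W.Dc i.1 : ℂ) * w₂ i + ∑ j : W.Inv, (W.comm i.1 j.1 : ℂ) * (w₂ i - w₂ j))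
          = ((‖u i.1 + (W.Dc i.1 : ℂ) * w₂ i‖ ^ 2 / W.Dc i.1 : ℝ) : ℂ)
            + conj (w₂ i) * ∑ j : W.Inv, (W.comm i.1 j.1 : ℂ) * (w₂ i - w₂ j) := by
        intro i
        rw [← pair_form_eq' i.2.ne']
        ring
      simp only [hsplit, Finset.sum_add_distrib, hRc, hP]
      push_cast
      rfl
    have hw₁v₁ : ∑ i : W.Inv, conj (u i.1) * v i.1 = (rl : ℂ) := by
      have h1 : ∑ i : W.Inv, conj (u i.1) * v i.1 = conj (∑ i : W.Inv, conj (v i.1) * u i.1) := by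
        rw [map_sum]
        refine Finset.sum_congr rfl fun i _ => ?_
        rw [map_mul, Complex.conj_conj, mul_comm]
      rw [h1, hRlI, Complex.conj_ofReal]
    have hright : ∑ i : W.Inv, (conj (u i.1) * (-μ * v i.1)
        + conj (w₂ i) * (-μ * (W.kgain i.1 : ℂ) * ((W.Dc i.1 : ℂ) * w₂ i)))
        = -μ * ((rl : ℂ) + (Nw : ℂ)) := by
      have h1 : ∑ i : W.Inv, (conj (u i.1) * (-μ * v i.1)
          + conj (w₂ i) * (-μ * (W.kgain i.1 : ℂ) * ((W.Dc i.1 : ℂ) * w₂ i)))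
          = -μ * (∑ i : W.Inv, conj (u i.1) * v i.1)
            + -μ * ∑ i : W.Inv, (W.kgain i.1 : ℂ) * (W.Dc i.1 : ℂ) * (conj (w₂ i) * w₂ i) := by
        rw [Finset.mul_sum, Finset.mul_sum, ← Finset.sum_add_distrib]
        refine Finset.sum_congr rfl fun i _ => ?_
        ring
      rw [h1, hw₁v₁, hNw]
      push_cast
      have h2 : ∑ i : W.Inv, (W.kgain i.1 : ℂ) * (W.Dc i.1 : ℂ) * (conj (w₂ i) * w₂ i)
          = ∑ i : W.Inv, (W.kgain i.1 : ℂ) * (W.Dc i.1 : ℂ) * ((‖w₂ i‖ : ℂ) ^ 2) := by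
        refine Finset.sum_congr rfl fun i _ => ?_
        rw [Complex.conj_mul']
      rw [h2]
      ring
    have hkey : (P : ℂ) + (rc : ℂ) = -μ * ((rl : ℂ) + (Nw : ℂ)) := by
      rw [← hleft, ← hright]
      refine Finset.sum_congr rfl fun i _ => ?_
      rw [hE1 i, hE2 i]
    -- case analysis on `N = rl + Nw`
    rcases (add_nonneg hrl0 hNw0).lt_or_eq with hNpos | hN0
    · left
      have hμ : μ = (( -(P + rc) / (rl + Nw) : ℝ) : ℂ) := by
        have hNC : ((rl + Nw : ℝ) : ℂ) ≠ 0 := by exact_mod_cast hNpos.ne'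
        push_cast at hNC ⊢
        field_simp
        linear_combination hkey
      rw [hμ, Complex.ofReal_re]
      apply div_neg_of_neg_of_pos _ hNpos
      rcases (add_nonneg hP0 hrc0).lt_or_eq with hpos | hzero
      · linarith
      · exfalso
        have hP00 : P = 0 := by linarith
        have hrc00 : rc = 0 := by linarith
        have hpair : ∀ i : W.Inv, u i.1 + (W.Dc i.1 : ℂ) * w₂ i = 0 := by
          intro i
          have hterm : ∀ j ∈ (Finset.univ : Finset W.Inv),
              0 ≤ ‖u j.1 + (W.Dc j.1 : ℂ) * w₂ j‖ ^ 2 / W.Dc j.1 :=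
            fun j _ => div_nonneg (sq_nonneg _) j.2.le
          have h0 := (Finset.sum_eq_zero_iff_of_nonneg hterm).1 (hP ▸ hP00) i (Finset.mem_univ i)
          rcases div_eq_zero_iff.1 h0 with h | h
          · exact norm_eq_zero.1 (pow_eq_zero_iff (n := 2) (by norm_num) |>.1 h)
          · exact absurd h i.2.ne'
        obtain ⟨b, hb⟩ := hrc_ker hrc00
        have hw₁b : ∀ i : W.Inv, u i.1 = -(b * (W.Dc i.1 : ℂ)) := fun i => by
          have := hpair i
          rw [hb] at this
          linear_combination this
        -- `Σ_{V_I} u_i = Σ_j u_j = 0`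
        have hsumu : ∑ i : W.Inv, u i.1 = 0 := by
          have h1 : ∑ j, u j = 0 := by
            have h2 : ∑ j, u j = ∑ j, ∑ j', (W.linWeight θs j j' : ℂ) * (v j - v j') :=
              Finset.sum_congr rfl fun j _ => by rw [hu, lap_map_mulVec_eq']
            rw [h2]; exact sum_lapRow_eq_zero' hℓs v
          rw [sum_split' (W := W) u] at h1
          simpa [huL] using h1
        have hDs : 0 < ∑ i : W.Inv, W.Dc i.1 :=
          Finset.sum_pos (fun i _ => i.2) ⟨i₀, Finset.mem_univ _⟩
        have hb0 : b = 0 := by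
          have h1 : ∑ i : W.Inv, u i.1 = -(b * ((∑ i : W.Inv, W.Dc i.1 : ℝ) : ℂ)) := by
            push_cast
            rw [Finset.mul_sum, ← Finset.sum_neg_distrib]
            exact Finset.sum_congr rfl fun i _ => hw₁b i
          rw [hsumu] at h1
          have hDsC : ((∑ i : W.Inv, W.Dc i.1 : ℝ) : ℂ) ≠ 0 := by exact_mod_cast hDs.ne'
          have : b * ((∑ i : W.Inv, W.Dc i.1 : ℝ) : ℂ) = 0 := by linear_combination h1
          exact (mul_eq_zero.1 this).resolve_right hDsC
        have hw₂0 : ∀ i : W.Inv, w₂ i = 0 := fun i => by rw [hb, hb0]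
        have hw₁0 : ∀ i : W.Inv, u i.1 = 0 := fun i => by rw [hw₁b i, hb0]; ring
        have hNw00 : Nw = 0 := by
          rw [hNw]
          exact Finset.sum_eq_zero fun i _ => by rw [hw₂0 i]; simp
        have hrl00 : rl = 0 := by
          have h1 : (rl : ℂ) = 0 := by
            rw [← hRlI]
            exact Finset.sum_eq_zero fun i _ => by rw [hw₁0 i, mul_zero]
          exact_mod_cast h1
        linarith
    · -- `N = 0`: `w₂ = 0` (so `q = 0`) and `rl = 0` (so `v` is constant): the rotation mode
      right
      have hrl00 : rl = 0 := by linarith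
      have hNw00 : Nw = 0 := by linarith
      have hw₂0 : ∀ i : W.Inv, w₂ i = 0 := by
        intro i
        have hterm : ∀ j ∈ (Finset.univ : Finset W.Inv), 0 ≤ W.kgain j.1 * W.Dc j.1 * ‖w₂ j‖ ^ 2 :=
          fun j _ => by have := hk j; have := j.2; positivity
        have h0 := (Finset.sum_eq_zero_iff_of_nonneg hterm).1 (hNw ▸ hNw00) i (Finset.mem_univ i)
        have hkD : W.kgain i.1 * W.Dc i.1 ≠ 0 := (mul_pos (hk i) i.2).ne'
        rcases mul_eq_zero.1 h0 with h | h
        · exact absurd h hkD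
        · exact norm_eq_zero.1 (pow_eq_zero_iff (n := 2) (by norm_num) |>.1 h)
      have hq0 : ∀ i : W.Inv, q i = 0 := fun i => by rw [hqw i, hw₂0 i, mul_zero]
      obtain ⟨a, ha⟩ := hrl_ker hrl00
      have hu0 : ∀ j, u j = 0 := fun j => by
        rw [hu, lap_map_mulVec_eq']
        simp only [ha, sub_self, mul_zero, Finset.sum_const_zero]
      have ha0 : a ≠ 0 := by
        intro ha0
        apply hx
        funext kk
        cases kk with
        | inl j => have := congrFun ha j; simp only [hv] at this; rw [this, ha0]; rfl
        | inr i => exact hq0 i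
      have hμ0 : μ = 0 := by
        have h1 := hE1 i₀
        rw [hu0 i₀.1, hw₂0 i₀, zero_div, add_zero] at h1
        have hva : v i₀.1 = a := congrFun ha i₀.1
        rw [hva] at h1
        have : μ * a = 0 := by linear_combination h1
        exact (mul_eq_zero.1 this).resolve_right ha0
      refine ⟨hμ0, a, funext fun kk => ?_⟩
      cases kk with
      | inl j => have := congrFun ha j; simpa [dlRot, hv] using this
      | inr i => have := hq0 i; simpa [dlRot, hq] using this

/-! ## §3 Theorem 8 (ii) with load nodes: local exponential stability of `(θ*, 0)` modulo the
rotation for the Kron-extended closed loop -/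

/-- The connectivity hypothesis of the communication graph among the inverters is a certificate:
`c ≥ 0` symmetric with a connected graph (cut form) ⇒ the real Laplacian form of `c` on the
inverters is `≥ 0` with kernel the constants.
[cite: SimpsonporcoDorflerBullo2013, §5 («weighted, undirected and connected communication graph between the inverters»)] -/
theorem commFormI_certificate_of_connected (hcs : ∀ i j : W.Inv, W.comm i.1 j.1 = W.comm j.1 i.1)
    (hc0 : ∀ i j : W.Inv, 0 ≤ W.comm i.1 j.1)
    (hconn : ∀ S : Finset W.Inv, S.Nonempty → Sᶜ.Nonempty → ∃ i ∈ S, ∃ j ∈ Sᶜ, 0 < W.comm i.1 j.1) :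
    (∀ u : W.Inv → ℝ, 0 ≤ ∑ i, u i * ∑ j, W.comm i.1 j.1 * (u i - u j)) ∧
    (∀ u : W.Inv → ℝ, ∑ i, u i * ∑ j, W.comm i.1 j.1 * (u i - u j) = 0 →
      ∃ a : ℝ, u = fun _ => a) := by
  classical
  have hterm : ∀ u : W.Inv → ℝ, ∀ i j, 0 ≤ W.comm i.1 j.1 * (u i - u j) ^ 2 :=
    fun u i j => mul_nonneg (hc0 i j) (sq_nonneg _)
  have half : ∀ u : W.Inv → ℝ, ∑ i, u i * ∑ j, W.comm i.1 j.1 * (u i - u j)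
      = 1 / 2 * ∑ i, ∑ j, W.comm i.1 j.1 * (u i - u j) ^ 2 := by
    intro u
    have e1 : ∑ i, u i * ∑ j, W.comm i.1 j.1 * (u i - u j)
        = ∑ i, ∑ j, W.comm i.1 j.1 * (u i * (u i - u j)) := by
      refine Finset.sum_congr rfl fun i _ => ?_
      rw [Finset.mul_sum]
      exact Finset.sum_congr rfl fun j _ => by ring
    have e2 : ∑ i, ∑ j, W.comm i.1 j.1 * (u i * (u i - u j))
        = ∑ i, ∑ j, W.comm i.1 j.1 * (u j * (u j - u i)) := by
      rw [Finset.sum_comm]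
      exact Finset.sum_congr rfl fun i _ => Finset.sum_congr rfl fun j _ => by rw [hcs j i]
    have e3 : ∑ i, ∑ j, W.comm i.1 j.1 * (u i * (u i - u j))
        + ∑ i, ∑ j, W.comm i.1 j.1 * (u j * (u j - u i))
        = ∑ i, ∑ j, W.comm i.1 j.1 * (u i - u j) ^ 2 := by
      rw [← Finset.sum_add_distrib]
      refine Finset.sum_congr rfl fun i _ => ?_
      rw [← Finset.sum_add_distrib]
      exact Finset.sum_congr rfl fun j _ => by ring
    rw [e1]
    linarith
  refine ⟨fun u => ?_, fun u hu => ?_⟩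
  · rw [half]
    exact mul_nonneg (by norm_num) (Finset.sum_nonneg fun i _ => Finset.sum_nonneg fun j _ =>
      hterm u i j)
  · rw [half] at hu
    have hsum : ∑ i, ∑ j, W.comm i.1 j.1 * (u i - u j) ^ 2 = 0 := by linarith
    have hij0 : ∀ i j, W.comm i.1 j.1 * (u i - u j) ^ 2 = 0 := by
      intro i j
      have hrow := (Finset.sum_eq_zero_iff_of_nonneg fun i _ =>
        Finset.sum_nonneg fun j _ => hterm u i j).1 hsum i (Finset.mem_univ i)
      exact (Finset.sum_eq_zero_iff_of_nonneg fun j _ => hterm u i j).1 hrow j (Finset.mem_univ j)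
    rcases isEmpty_or_nonempty W.Inv with hE | ⟨⟨i₀⟩⟩
    · exact ⟨0, funext fun i => (IsEmpty.false i).elim⟩
    refine ⟨u i₀, ?_⟩
    -- the set where `u` takes the value `u i₀` has no outgoing edge, hence is everything
    set S : Finset W.Inv := Finset.univ.filter fun i => u i = u i₀ with hS
    by_contra hne
    have hSc : Sᶜ.Nonempty := by
      by_contra hempty
      rw [Finset.not_nonempty_iff_eq_empty, Finset.compl_eq_empty_iff] at hempty
      apply hne
      funext i
      have hi : i ∈ S := by rw [hempty]; exact Finset.mem_univ i
      rw [hS, Finset.mem_filter] at hi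
      exact hi.2
    have hSne : S.Nonempty := ⟨i₀, by rw [hS, Finset.mem_filter]; exact ⟨Finset.mem_univ _, rfl⟩⟩
    obtain ⟨i, hi, j, hj, hcij⟩ := hconn S hSne hSc
    have h0 : (u i - u j) ^ 2 = 0 := by
      rcases mul_eq_zero.1 (hij0 i j) with h | h
      · exact absurd h hcij.ne'
      · exact h
    have huij : u i = u j := by
      have := pow_eq_zero_iff (n := 2) (by norm_num) |>.1 h0
      linarith
    rw [hS, Finset.mem_filter] at hi
    rw [Finset.mem_compl, hS, Finset.mem_filter] at hj
    exact hj ⟨Finset.mem_univ j, by rw [← huij, hi.2]⟩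

/-- **LES within a leaf of the conserved quantity `Σ D_iθ_i − Σ_{V_I} k_ip̃_i`** for the Kron-extended
closed loop: `D_i ≥ 0`, at least one inverter `i₀`, `k_i > 0`, symmetric `|Y|` and `c`, an
(Aux)-equilibrium `θ*` with the PSD + kernel certificates for `L(θ*)` (all nodes) and `L_c`
(inverters). [cite: SimpsonporcoDorflerBullo2013, Theorem 8 (ii) and App. C (proof with `V_L ≠ ∅`)] -/
theorem dl_expStable_within_leaf (hD : ∀ i, 0 ≤ W.Dc i) (i₀ : W.Inv) (hk : ∀ i : W.Inv, 0 < W.kgain i.1)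
    (hY : ∀ i j, W.Yabs i j = W.Yabs j i) (hcs : ∀ i j : W.Inv, W.comm i.1 j.1 = W.comm j.1 i.1)
    {θs : Fin n → ℝ} (hθs : W.IsAuxEquilibrium θs)
    (hpsd : ∀ u : Fin n → ℝ, 0 ≤ ∑ i, u i * ∑ j, W.linWeight θs i j * (u i - u j))
    (hker : ∀ u : Fin n → ℝ, ∑ i, u i * ∑ j, W.linWeight θs i j * (u i - u j) = 0 →
      ∃ a : ℝ, u = fun _ => a)
    (hcpsd : ∀ u : W.Inv → ℝ, 0 ≤ ∑ i, u i * ∑ j, W.comm i.1 j.1 * (u i - u j))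
    (hcker : ∀ u : W.Inv → ℝ, ∑ i, u i * ∑ j, W.comm i.1 j.1 * (u i - u j) = 0 →
      ∃ a : ℝ, u = fun _ => a) :
    ∃ ρ > 0, ∃ k > 0, ∃ lam > 0, ∀ (X : ℝ → Fin n ⊕ W.Inv → ℝ) (T : ℝ),
      (∀ t ∈ Icc 0 T, HasDerivWithinAt X (W.dlField θs (X t)) (Icc 0 T) t) →
      W.dlWeights ⬝ᵥ X 0 = W.dlWeights ⬝ᵥ W.lphase θs 0 →
      ‖X 0 - W.lphase θs 0‖ < ρ →
      ∀ t ∈ Icc 0 T, ‖X t - W.lphase θs 0‖ ≤ k * ‖X 0 - W.lphase θs 0‖ * Real.exp (-lam * t) := by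
  have hDs : 0 < ∑ i, W.Dc i :=
    lt_of_lt_of_le i₀.2 (Finset.single_le_sum (fun i _ => hD i) (Finset.mem_univ i₀.1))
  have hU : IsUnit (W.lapLL θs).det := DroopNetwork.isUnit_lapLL_det (N := W.toDroopNetwork) hker i₀
  have hlr : W.dlWeights ⬝ᵥ W.dlRot ≠ 0 := by rw [dlWeights_dotProduct_dlRot]; exact hDs.ne'
  exact Literature.Analysis.ODE.exists_expStable_within_of_eig_re_neg_or_smul
    (hasFDerivAt_dlField hθs hU) (dlField_equilibrium hθs)
    (fun x => dlWeights_dotProduct_dlField hD (fun i => (hk i).ne') hcs θs x) hlr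
    (fun μ v hv hJ => dlJac_eig_re_neg_or_rotation hk hY hcs hpsd hker hcpsd hcker i₀ hv hJ)

/-- `|Σ(D, −k_I)·h| ≤ (Σ D_i + Σ_{V_I} k_i)‖h‖` (sup norm). [folklore] -/
private theorem abs_dlWeights_dotProduct_le (hD : ∀ i, 0 ≤ W.Dc i) (hk : ∀ i : W.Inv, 0 ≤ W.kgain i.1)
    (h : Fin n ⊕ W.Inv → ℝ) :
    |W.dlWeights ⬝ᵥ h| ≤ (∑ i, W.Dc i + ∑ i : W.Inv, W.kgain i.1) * ‖h‖ := by
  have hw : ∀ kk, |W.dlWeights kk| * ‖h‖ ≥ |W.dlWeights kk * h kk| := fun kk => by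
    rw [abs_mul]
    exact mul_le_mul_of_nonneg_left (by simpa using norm_le_pi_norm h kk) (abs_nonneg _)
  have habs : ∑ kk, |W.dlWeights kk| = ∑ i, W.Dc i + ∑ i : W.Inv, W.kgain i.1 := by
    simp only [Fintype.sum_sum_type, dlWeights, Sum.elim_inl, Sum.elim_inr, abs_neg]
    congr 1
    · exact Finset.sum_congr rfl fun i _ => abs_of_nonneg (hD i)
    · exact Finset.sum_congr rfl fun i _ => abs_of_nonneg (hk i)
  calc |W.dlWeights ⬝ᵥ h| = |∑ kk, W.dlWeights kk * h kk| := rfl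
    _ ≤ ∑ kk, |W.dlWeights kk * h kk| := Finset.abs_sum_le_sum_abs _ _
    _ ≤ ∑ kk, |W.dlWeights kk| * ‖h‖ := Finset.sum_le_sum fun kk _ => hw kk
    _ = (∑ i, W.Dc i + ∑ i : W.Inv, W.kgain i.1) * ‖h‖ := by rw [← Finset.sum_mul, habs]

/-- **From the leaf to every nearby state** (the conserved quantity picks the rotation): with the
within-leaf estimate as hypothesis `H`, every solution of `X' = dlField θ* X` on `[0, T]` with
`‖X(0) − (θ*, 0)‖ < ρ/(1 + K)`, `K = (Σ D_i + Σ_{V_I} k_i)/Σ D_i`, satisfies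
`‖X(t) − (θ* + c𝟙, 0)‖ ≤ k‖X(0) − (θ* + c𝟙, 0)‖e^{−λt}`, `c = (D, −k_I)·(X(0) − (θ*, 0))/Σ D_i`.
[cite: SimpsonporcoDorflerBullo2013, App. C («modulo rotational symmetry»)] -/
theorem dl_expStable_modRotation_of_within_leaf (hD : ∀ i, 0 ≤ W.Dc i) (i₀ : W.Inv)
    (hk : ∀ i : W.Inv, 0 < W.kgain i.1) {θs : Fin n → ℝ} {ρ k lam : ℝ}
    (H : ∀ (X : ℝ → Fin n ⊕ W.Inv → ℝ) (T : ℝ),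
      (∀ t ∈ Icc 0 T, HasDerivWithinAt X (W.dlField θs (X t)) (Icc 0 T) t) →
      W.dlWeights ⬝ᵥ X 0 = W.dlWeights ⬝ᵥ W.lphase θs 0 →
      ‖X 0 - W.lphase θs 0‖ < ρ →
      ∀ t ∈ Icc 0 T, ‖X t - W.lphase θs 0‖ ≤ k * ‖X 0 - W.lphase θs 0‖ * Real.exp (-lam * t)) :
    ∀ (X : ℝ → Fin n ⊕ W.Inv → ℝ) (T : ℝ),
      (∀ t ∈ Icc 0 T, HasDerivWithinAt X (W.dlField θs (X t)) (Icc 0 T) t) →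
      ‖X 0 - W.lphase θs 0‖ < ρ / (1 + (∑ i, W.Dc i + ∑ i : W.Inv, W.kgain i.1) / ∑ i, W.Dc i) →
      ∀ t ∈ Icc 0 T,
        ‖X t - fun kk => W.lphase θs 0 kk
            + W.dlWeights ⬝ᵥ (X 0 - W.lphase θs 0) / (∑ i, W.Dc i) * W.dlRot kk‖
          ≤ k * ‖X 0 - fun kk => W.lphase θs 0 kk
              + W.dlWeights ⬝ᵥ (X 0 - W.lphase θs 0) / (∑ i, W.Dc i) * W.dlRot kk‖
            * Real.exp (-lam * t) := by
  intro X T hX h0 t ht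
  have hDs : 0 < ∑ i, W.Dc i :=
    lt_of_lt_of_le i₀.2 (Finset.single_le_sum (fun i _ => hD i) (Finset.mem_univ i₀.1))
  obtain ⟨K, hKdef⟩ : ∃ K : ℝ, K = (∑ i, W.Dc i + ∑ i : W.Inv, W.kgain i.1) / ∑ i, W.Dc i := ⟨_, rfl⟩
  have hK0 : 0 ≤ K := hKdef ▸ div_nonneg
    (add_nonneg hDs.le (Finset.sum_nonneg fun i _ => (hk i).le)) hDs.le
  rw [← hKdef] at h0
  set x₀ : Fin n ⊕ W.Inv → ℝ := W.lphase θs 0 with hx₀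
  set c : ℝ := W.dlWeights ⬝ᵥ (X 0 - x₀) / ∑ i, W.Dc i with hcdef
  set Y : ℝ → Fin n ⊕ W.Inv → ℝ := fun s kk => X s kk - c * W.dlRot kk with hYdef
  have hYsol : ∀ s ∈ Icc 0 T, HasDerivWithinAt Y (W.dlField θs (Y s)) (Icc 0 T) s := by
    intro s hs
    have h1 : HasDerivWithinAt Y (W.dlField θs (X s) - 0) (Icc 0 T) s :=
      (hX s hs).sub (hasDerivWithinAt_const s (Icc 0 T) (fun kk : Fin n ⊕ W.Inv => c * W.dlRot kk))
    have h2 : W.dlField θs (Y s) = W.dlField θs (X s) := by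
      have := dlField_add_rot (W := W) θs (X s) (-c)
      simpa [hYdef, sub_eq_add_neg, neg_mul] using this
    rw [h2, ← sub_zero (W.dlField θs (X s))]
    exact h1
  have hYleaf : W.dlWeights ⬝ᵥ Y 0 = W.dlWeights ⬝ᵥ x₀ := by
    have h1 : W.dlWeights ⬝ᵥ Y 0 = W.dlWeights ⬝ᵥ X 0 - c * (W.dlWeights ⬝ᵥ W.dlRot) := by
      simp only [hYdef, dotProduct, mul_sub, Finset.sum_sub_distrib, Finset.mul_sum]
      congr 1
      refine Finset.sum_congr rfl fun kk _ => ?_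
      ring
    have h2 : c * (W.dlWeights ⬝ᵥ W.dlRot) = W.dlWeights ⬝ᵥ X 0 - W.dlWeights ⬝ᵥ x₀ := by
      rw [dlWeights_dotProduct_dlRot, hcdef, div_mul_cancel₀ _ hDs.ne', dotProduct_sub]
    rw [h1, h2]
    ring
  have hY0 : ‖Y 0 - x₀‖ < ρ := by
    have hc : |c| ≤ K * ‖X 0 - x₀‖ := by
      rw [hcdef, abs_div, abs_of_pos hDs, div_le_iff₀ hDs, hKdef]
      calc |W.dlWeights ⬝ᵥ (X 0 - x₀)| ≤ (∑ i, W.Dc i + ∑ i : W.Inv, W.kgain i.1) * ‖X 0 - x₀‖ :=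
            abs_dlWeights_dotProduct_le hD (fun i => (hk i).le) _
        _ = (∑ i, W.Dc i + ∑ i : W.Inv, W.kgain i.1) / (∑ i, W.Dc i) * ‖X 0 - x₀‖ * ∑ i, W.Dc i := by
            field_simp
    have hdecomp : Y 0 - x₀ = (X 0 - x₀) - fun kk => c * W.dlRot kk := by
      funext kk; simp [hYdef]; ring
    have hrot : ‖fun kk : Fin n ⊕ W.Inv => c * W.dlRot kk‖ ≤ |c| := by
      refine (pi_norm_le_iff_of_nonneg (abs_nonneg c)).2 fun kk => ?_
      cases kk with
      | inl i => simp [dlRot]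
      | inr i => simp [dlRot]
    have hX0 : (1 + K) * ‖X 0 - x₀‖ < ρ := by
      have := h0
      rw [lt_div_iff₀ (by positivity)] at this
      linarith
    calc ‖Y 0 - x₀‖ = ‖(X 0 - x₀) - fun kk => c * W.dlRot kk‖ := by rw [hdecomp]
      _ ≤ ‖X 0 - x₀‖ + ‖fun kk : Fin n ⊕ W.Inv => c * W.dlRot kk‖ := norm_sub_le _ _
      _ ≤ ‖X 0 - x₀‖ + K * ‖X 0 - x₀‖ := by linarith [hrot, hc]
      _ = (1 + K) * ‖X 0 - x₀‖ := by ring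
      _ < ρ := hX0
  have key := H Y T hYsol hYleaf hY0 t ht
  have hshape : ∀ s, Y s - x₀ = X s - fun kk => x₀ kk + c * W.dlRot kk := fun s => by
    funext kk; simp [hYdef]; ring
  rw [hshape t, hshape 0] at key
  exact key

/-- **SPDB2013 Theorem 8 (ii), stability clause, WITH LOAD NODES — certificate form, for the
Kron-extended closed loop.**  `D_i ≥ 0`, at least one inverter `i₀`, `k_i > 0`, symmetric `|Y|` and
communication weights, an (Aux)-equilibrium `θ*` (Theorem 2 (ii)'s angle array, loads included) with
the PSD + kernel certificates for the linearised network Laplacian `L(θ*)` (all nodes) and for the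
communication Laplacian (inverters).  Then `∃ ρ, k, λ > 0`: every solution `x = (θ, p̃)` of the
Kron-extended closed loop `x' = dlField θ* x` on `[0, T]` with `‖x(0) − (θ*, 0)‖ < ρ` satisfies
`‖x(t) − (θ* + c𝟙, 0)‖ ≤ k‖x(0) − (θ* + c𝟙, 0)‖e^{−λt}` on `[0, T]`,
`c = (Σ_i D_i(θ_i(0) − θ*_i) − Σ_{V_I} k_ip̃_i(0))/Σ_i D_i` — local exponential stability of the
equilibrium MANIFOLD `(θ* + ℝ𝟙, 0)` («locally exponentially stable … modulo rotational symmetry»).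
On the constraint manifold `m_L(θ) = 0` the flow is the printed differential-algebraic closed loop
(rot2); every DAE solution with `L_LL(θ(t))` invertible is such an `x` (Theorem 2's file, §6).
MODEL: droop-controlled inverters with the DAPI secondary loop, constant-power loads, lossless,
constant voltages; `ρ, k, λ` existential.
[cite: SimpsonporcoDorflerBullo2013, Theorem 8 (ii) («a locally exponentially stable and unique equilibrium `(θ*, p*) ∈ Δ_G(γ) × ℝ^{|V_I|}`») and App. C (proof with `V_L ≠ ∅`)] -/
theorem dlEquilibrium_locally_expStable_of_certificates (hD : ∀ i, 0 ≤ W.Dc i) (i₀ : W.Inv)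
    (hk : ∀ i : W.Inv, 0 < W.kgain i.1) (hY : ∀ i j, W.Yabs i j = W.Yabs j i)
    (hcs : ∀ i j : W.Inv, W.comm i.1 j.1 = W.comm j.1 i.1) {θs : Fin n → ℝ}
    (hθs : W.IsAuxEquilibrium θs)
    (hpsd : ∀ u : Fin n → ℝ, 0 ≤ ∑ i, u i * ∑ j, W.linWeight θs i j * (u i - u j))
    (hker : ∀ u : Fin n → ℝ, ∑ i, u i * ∑ j, W.linWeight θs i j * (u i - u j) = 0 →
      ∃ a : ℝ, u = fun _ => a)
    (hcpsd : ∀ u : W.Inv → ℝ, 0 ≤ ∑ i, u i * ∑ j, W.comm i.1 j.1 * (u i - u j))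
    (hcker : ∀ u : W.Inv → ℝ, ∑ i, u i * ∑ j, W.comm i.1 j.1 * (u i - u j) = 0 →
      ∃ a : ℝ, u = fun _ => a) :
    ∃ ρ > 0, ∃ k > 0, ∃ lam > 0, ∀ (X : ℝ → Fin n ⊕ W.Inv → ℝ) (T : ℝ),
      (∀ t ∈ Icc 0 T, HasDerivWithinAt X (W.dlField θs (X t)) (Icc 0 T) t) →
      ‖X 0 - W.lphase θs 0‖ < ρ →
      ∀ t ∈ Icc 0 T,
        ‖X t - fun kk => W.lphase θs 0 kk
            + W.dlWeights ⬝ᵥ (X 0 - W.lphase θs 0) / (∑ i, W.Dc i) * W.dlRot kk‖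
          ≤ k * ‖X 0 - fun kk => W.lphase θs 0 kk
              + W.dlWeights ⬝ᵥ (X 0 - W.lphase θs 0) / (∑ i, W.Dc i) * W.dlRot kk‖
            * Real.exp (-lam * t) := by
  obtain ⟨ρ, hρ, k, hk', lam, hlam, H⟩ :=
    dl_expStable_within_leaf hD i₀ hk hY hcs hθs hpsd hker hcpsd hcker
  have hDs : 0 < ∑ i, W.Dc i :=
    lt_of_lt_of_le i₀.2 (Finset.single_le_sum (fun i _ => hD i) (Finset.mem_univ i₀.1))
  have hK0 : 0 ≤ (∑ i, W.Dc i + ∑ i : W.Inv, W.kgain i.1) / ∑ i, W.Dc i :=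
    div_nonneg (add_nonneg hDs.le (Finset.sum_nonneg fun i _ => (hk i).le)) hDs.le
  exact ⟨ρ / (1 + (∑ i, W.Dc i + ∑ i : W.Inv, W.kgain i.1) / ∑ i, W.Dc i), by positivity, k, hk',
    lam, hlam, fun X T hX h0 => dl_expStable_modRotation_of_within_leaf hD i₀ hk H X T hX h0⟩

/-- **Theorem 8 (ii) with load nodes, printed hypotheses**: `θ* ∈ Δ_G(γ)`, `γ < π/2`
(`|θ*_i − θ*_j| < π/2` across every coupled pair), couplings `a_ij ≥ 0` with a connected coupling
graph, and communication weights `c_ij ≥ 0` among the inverters with a connected communication graph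
(cut form) — for the Kron-extended closed loop.
[cite: SimpsonporcoDorflerBullo2013, Theorem 8 (ii) and App. C; §3 proof of Theorem 2 (b) (`L(θ*)` is a Laplacian … positive semidefinite)] -/
theorem dlEquilibrium_locally_expStable (hD : ∀ i, 0 ≤ W.Dc i) (i₀ : W.Inv)
    (hk : ∀ i : W.Inv, 0 < W.kgain i.1) (hY : ∀ i j, W.Yabs i j = W.Yabs j i)
    (ha : ∀ i j, 0 ≤ W.a i j) (hconn : ClassicalModel.CouplingConnected W.a)
    (hcs : ∀ i j : W.Inv, W.comm i.1 j.1 = W.comm j.1 i.1) (hc0 : ∀ i j : W.Inv, 0 ≤ W.comm i.1 j.1)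
    (hcconn : ∀ S : Finset W.Inv, S.Nonempty → Sᶜ.Nonempty → ∃ i ∈ S, ∃ j ∈ Sᶜ, 0 < W.comm i.1 j.1)
    {θs : Fin n → ℝ} (hθs : W.IsAuxEquilibrium θs)
    (harc : ∀ i j, i ≠ j → 0 < W.a i j → |θs i - θs j| < Real.pi / 2) :
    ∃ ρ > 0, ∃ k > 0, ∃ lam > 0, ∀ (X : ℝ → Fin n ⊕ W.Inv → ℝ) (T : ℝ),
      (∀ t ∈ Icc 0 T, HasDerivWithinAt X (W.dlField θs (X t)) (Icc 0 T) t) →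
      ‖X 0 - W.lphase θs 0‖ < ρ →
      ∀ t ∈ Icc 0 T,
        ‖X t - fun kk => W.lphase θs 0 kk
            + W.dlWeights ⬝ᵥ (X 0 - W.lphase θs 0) / (∑ i, W.Dc i) * W.dlRot kk‖
          ≤ k * ‖X 0 - fun kk => W.lphase θs 0 kk
              + W.dlWeights ⬝ᵥ (X 0 - W.lphase θs 0) / (∑ i, W.Dc i) * W.dlRot kk‖
            * Real.exp (-lam * t) := by
  obtain ⟨hpsd, hker⟩ :=
    DroopNetwork.posCurvature_of_arc (N := W.toDroopNetwork) ha hconn hY harc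
  obtain ⟨hcpsd, hcker⟩ := commFormI_certificate_of_connected hcs hc0 hcconn
  exact dlEquilibrium_locally_expStable_of_certificates hD i₀ hk hY hcs hθs hpsd hker hcpsd hcker

/-! ## §4 The printed differential-algebraic closed loop (load – closed loop)–(secondary control –
closed loop): its solutions, in the error coordinates `p̃ = p − D_Iω_avg`, solve the Kron-extended
flow while `L_LL(θ(t))` is invertible; the bootstrap; Theorem 8 (ii) with load nodes for the DAE -/

variable (W) in
/-- **Solutions of the DAPI closed loop WITH LOAD NODES**, componentwise at time `t`: at the
inverters `i ∈ V_I` (`D_i > 0`) `D_iθ̇_i = P*_i − p_i − P_e,i(θ)` and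
`k_iṗ_i = P*_i − p_i − P_e,i(θ) − Σ_{j∈V_I} c_ij(p_i/D_i − p_j/D_j)` (the printed `L_cD_I⁻¹p`
written with the adjacency weights of `G_c`); at the loads `l ∈ V_L` (`D_l = 0`) the algebraic power
balance `0 = P*_l − P_e,l(θ)`, the load angle being differentiable (a classical solution of the
differential-algebraic system).
[cite: SimpsonporcoDorflerBullo2013, §5 eqs. (load – closed loop), (primary control – closed loop), (secondary control – closed loop) (held text p0012 L38–L52)] -/
def IsSolutionLoadsAt (θ : ℝ → Fin n → ℝ) (p : ℝ → W.Inv → ℝ) (t : ℝ) : Prop :=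
  (∀ i : W.Inv,
    HasDerivAt (fun s => θ s i.1) ((W.Pstar i.1 - p t i - W.injection (θ t) i.1) / W.Dc i.1) t ∧
    HasDerivAt (fun s => p s i)
      ((W.Pstar i.1 - p t i - W.injection (θ t) i.1
        - ∑ j : W.Inv, W.comm i.1 j.1 * (p t i / W.Dc i.1 - p t j / W.Dc j.1)) / W.kgain i.1) t) ∧
  ∀ l : W.Load, (∃ w : ℝ, HasDerivAt (fun s => θ s l.1) w t) ∧ W.Pstar l.1 = W.injection (θ t) l.1

/-- `θ ↦ L_LL(θ)` is continuous. [folklore] -/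
private theorem continuous_lapLL' : Continuous fun θ : Fin n → ℝ => W.lapLL θ := by
  refine continuous_pi fun a => continuous_pi fun b => ?_
  simp only [DroopNetwork.lapLL, DroopNetwork.lap, DroopNetwork.linWeight]
  by_cases hab : a.1 = b.1
  · simp only [hab, if_true]; fun_prop
  · simp only [hab, if_false]; fun_prop

/-- The derivative of the mismatch, applied: `−(L(θ)h)_i`. [folklore] -/
private theorem mismatchDeriv_apply' (θs : Fin n → ℝ) (i : Fin n) (h : Fin n → ℝ) :
    ((-(∑ j, W.linWeight θs i j •
        ((ContinuousLinearMap.proj i : (Fin n → ℝ) →L[ℝ] ℝ) - ContinuousLinearMap.proj j)))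
        : (Fin n → ℝ) →L[ℝ] ℝ) h
      = -((W.lap θs *ᵥ h) i) := by
  rw [DroopNetwork.lap_mulVec]
  simp only [neg_apply, _root_.sum_apply, smul_apply, sub_apply, ContinuousLinearMap.proj_apply,
    smul_eq_mul]

/-- **Constraint differentiation.**  If the angle curve `θ` has velocity `V` at `t`, the load
constraints `m_l(θ(s)) = 0` hold at all times and `L_LL(θ(t))` is invertible, then the load
velocities are determined by the inverter velocities: `θ̇_L = G(θ)θ̇_I`, `G(θ) = −L_LL(θ)⁻¹L_LI(θ)`
(`L_LL(θ)θ̇_L + L_LI(θ)θ̇_I = 0`).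
[cite: SimpsonporcoDorflerBullo2013, App. C («we linearize the DAE … and eliminate the resulting algebraic equations, as in the proof of Theorem 2») and §3 proof of Theorem 2 (b) («solving the set of `|V_L|` algebraic equations»)] -/
theorem loadVelocity_eq_elim_mulVec {θ : ℝ → Fin n → ℝ} {t : ℝ} {V : Fin n → ℝ}
    (hV : HasDerivAt θ V t) (hL : ∀ (l : W.Load) (s : ℝ), W.mismatch (θ s) l.1 = 0)
    (hU : IsUnit (W.lapLL (θ t)).det) :
    (fun l : W.Load => V l.1) = W.elim (θ t) *ᵥ fun i : W.Inv => V i.1 := by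
  classical
  -- differentiate the constraints: `(L(θ t) V)_l = 0`
  have hLV : ∀ l : W.Load, (W.lap (θ t) *ᵥ V) l.1 = 0 := by
    intro l
    have h1 : HasDerivAt (fun s => W.mismatch (θ s) l.1)
        (((-(∑ j, W.linWeight (θ t) l.1 j •
          ((ContinuousLinearMap.proj l.1 : (Fin n → ℝ) →L[ℝ] ℝ) - ContinuousLinearMap.proj j)))
            : (Fin n → ℝ) →L[ℝ] ℝ) V) t :=
      (DroopNetwork.hasFDerivAt_mismatch (N := W.toDroopNetwork) (θ t) l.1).comp_hasDerivAt t hV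
    have h2 : HasDerivAt (fun s => W.mismatch (θ s) l.1) 0 t := by
      have : (fun s => W.mismatch (θ s) l.1) = fun _ => 0 := funext fun s => hL l s
      rw [this]; exact hasDerivAt_const t 0
    have h3 := h1.unique h2
    rw [mismatchDeriv_apply'] at h3
    linarith
  -- solve for the load velocities
  have hsplitV : ∀ l : W.Load,
      (W.lapLL (θ t) *ᵥ fun l' : W.Load => V l'.1) l
        = -(W.lapLI (θ t) *ᵥ fun i : W.Inv => V i.1) l := by
    intro l
    have h := hLV l
    simp only [Matrix.mulVec, dotProduct] at h ⊢
    rw [sum_split' (W := W)] at h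
    simp only [DroopNetwork.lapLL, DroopNetwork.lapLI]
    linarith
  have h1 : (W.lapLL (θ t) *ᵥ fun l' : W.Load => V l'.1)
      = -(W.lapLI (θ t) *ᵥ fun i : W.Inv => V i.1) := funext hsplitV
  calc (fun l' : W.Load => V l'.1)
      = ((W.lapLL (θ t))⁻¹ * W.lapLL (θ t)) *ᵥ (fun l' : W.Load => V l'.1) := by
        rw [Matrix.nonsing_inv_mul _ hU, Matrix.one_mulVec]
    _ = (W.lapLL (θ t))⁻¹ *ᵥ -(W.lapLI (θ t) *ᵥ fun i : W.Inv => V i.1) := by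
        rw [← Matrix.mulVec_mulVec, h1]
    _ = W.elim (θ t) *ᵥ fun i : W.Inv => V i.1 := by
        rw [Matrix.mulVec_neg, DroopNetwork.elim, Matrix.neg_mulVec, Matrix.mulVec_mulVec]

/-- Along a solution of the differential-algebraic closed loop with `D ≥ 0` the load constraints
`m_l(θ(s)) = P*_l − P_e,l(θ(s)) = 0` hold at all times (`P̃_l = P*_l` at a load).
[cite: SimpsonporcoDorflerBullo2013, §5 eq. (load – closed loop)] -/
theorem mismatch_load_eq_zero_of_isSolutionLoadsAt (hD : ∀ i, 0 ≤ W.Dc i) {θ : ℝ → Fin n → ℝ}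
    {p : ℝ → W.Inv → ℝ} (hsol : ∀ t, W.IsSolutionLoadsAt θ p t) (l : W.Load) (s : ℝ) :
    W.mismatch (θ s) l.1 = 0 := by
  rw [DroopNetwork.mismatch, DroopNetwork.shiftedInjection,
    DroopNetwork.dc_load (N := W.toDroopNetwork) hD l, mul_zero, sub_zero, ((hsol s).2 l).2, sub_self]

/-- A solution of the differential-algebraic closed loop, read in the error coordinates
`x(s) = (θ(s), p(s) − D_Iω_avg)`, is a differentiable curve in `ℝⁿ × ℝ^{V_I}`. [folklore] -/
private theorem exists_hasDerivAt_lphase_of_isSolutionLoadsAt {θ : ℝ → Fin n → ℝ} {p : ℝ → W.Inv → ℝ}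
    (hsol : ∀ t, W.IsSolutionLoadsAt θ p t) (s : ℝ) :
    ∃ V : Fin n ⊕ W.Inv → ℝ,
      HasDerivAt (fun s => W.lphase (θ s) (fun i => p s i - W.Dc i.1 * W.avgFrequency)) V s := by
  have hcomp : ∀ kk : Fin n ⊕ W.Inv, ∃ v : ℝ,
      HasDerivAt (fun s => W.lphase (θ s) (fun i => p s i - W.Dc i.1 * W.avgFrequency) kk) v s := by
    intro kk
    cases kk with
    | inl j =>
      by_cases hj : 0 < W.Dc j
      · exact ⟨_, ((hsol s).1 ⟨j, hj⟩).1⟩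
      · exact ((hsol s).2 ⟨j, hj⟩).1
    | inr i => exact ⟨_, ((hsol s).1 i).2.sub_const (W.Dc i.1 * W.avgFrequency)⟩
  choose V hV using hcomp
  exact ⟨V, hasDerivAt_pi.2 hV⟩

/-- **The differential-algebraic closed loop solves the Kron-extended flow** while `L_LL(θ(t))` is
invertible: for a solution `(θ, p)` of (load – closed loop)–(secondary control – closed loop) at every
time and `D ≥ 0`, the state `x(t) = (θ(t), p(t) − D_Iω_avg)` satisfies `ẋ(t) = dlField θ* (x(t))` at
every `t` at which `L_LL(θ(t))` is invertible — the load velocities are solved from the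
differentiated constraints (`L_LLθ̇_L + L_LIθ̇_I = 0`), the inverter rows are
`(P̃_i − P_e,i − p̃_i)/D_i`, the secondary rows `(P̃_i − P_e,i − p̃_i − (L_cD_I⁻¹p̃)_i)/k_i`
(`L_cD_I⁻¹(D_Iω_avg𝟙) = 0`).
[cite: SimpsonporcoDorflerBullo2013, App. C (error coordinates `p̃_i(t) = p_i(t) − D_iω_avg`, eqs. (rot2); «eliminate the resulting algebraic equations, as in the proof of Theorem 2»)] -/
theorem hasDerivAt_lphase_of_isSolutionLoadsAt (hD : ∀ i, 0 ≤ W.Dc i) {θ : ℝ → Fin n → ℝ}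
    {p : ℝ → W.Inv → ℝ} (hsol : ∀ t, W.IsSolutionLoadsAt θ p t) (θs : Fin n → ℝ) {t : ℝ}
    (hU : IsUnit (W.lapLL (θ t)).det) :
    HasDerivAt (fun s => W.lphase (θ s) (fun i => p s i - W.Dc i.1 * W.avgFrequency))
      (W.dlField θs (W.lphase (θ t) (fun i => p t i - W.Dc i.1 * W.avgFrequency))) t := by
  classical
  -- the angle velocities
  have hθex : ∀ j, ∃ w : ℝ, HasDerivAt (fun s => θ s j) w t := by
    intro j
    by_cases hj : 0 < W.Dc j
    · exact ⟨_, ((hsol t).1 ⟨j, hj⟩).1⟩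
    · exact ((hsol t).2 ⟨j, hj⟩).1
  choose Vθ hVθ using hθex
  have hVθ' : HasDerivAt θ Vθ t := hasDerivAt_pi.2 hVθ
  have hVI : ∀ i : W.Inv, Vθ i.1 = (W.Pstar i.1 - p t i - W.injection (θ t) i.1) / W.Dc i.1 :=
    fun i => (hVθ i.1).unique ((hsol t).1 i).1
  -- the constraints and the load velocities
  have hL : ∀ (l : W.Load) (s : ℝ), W.mismatch (θ s) l.1 = 0 :=
    mismatch_load_eq_zero_of_isSolutionLoadsAt hD hsol
  have hVL := loadVelocity_eq_elim_mulVec hVθ' hL hU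
  -- compare with the field
  set q : W.Inv → ℝ := fun i => p t i - W.Dc i.1 * W.avgFrequency with hq
  have hmL : (fun l : W.Load => W.mismatch (θ t) l.1) = 0 := funext fun l => hL l t
  have hFI : W.dlFieldI θs (θ t) q = fun i : W.Inv => Vθ i.1 := by
    funext i
    simp only [dlFieldI, DroopNetwork.kronFieldI, hmL, Matrix.mulVec_zero, Pi.zero_apply, sub_zero]
    rw [hVI i, DroopNetwork.mismatch, DroopNetwork.shiftedInjection, hq, div_sub_div_same]
    congr 1
    ring
  have hquot : ∀ i j : W.Inv, q i / W.Dc i.1 - q j / W.Dc j.1 = p t i / W.Dc i.1 - p t j / W.Dc j.1 := by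
    intro i j
    simp only [hq]
    rw [sub_div, sub_div, mul_div_cancel_left₀ _ i.2.ne', mul_div_cancel_left₀ _ j.2.ne']
    ring
  have hFP : ∀ i : W.Inv, W.dlFieldP θs (θ t) q i
      = (W.Pstar i.1 - p t i - W.injection (θ t) i.1
          - ∑ j : W.Inv, W.comm i.1 j.1 * (p t i / W.Dc i.1 - p t j / W.Dc j.1)) / W.kgain i.1 := by
    intro i
    rw [dlFieldP, hFI]
    simp only [hquot, hVI i, mul_div_cancel₀ _ i.2.ne']
  have hθpart : (fun j' => W.lphase (θ t) q (Sum.inl j')) = θ t := rfl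
  have hqpart : (fun i' => W.lphase (θ t) q (Sum.inr i')) = q := rfl
  refine hasDerivAt_pi.2 fun kk => ?_
  cases kk with
  | inl j =>
    show HasDerivAt (fun s => θ s j) (W.dlField θs (W.lphase (θ t) q) (Sum.inl j)) t
    by_cases hj : 0 < W.Dc j
    · have hval : W.dlField θs (W.lphase (θ t) q) (Sum.inl j) = Vθ j := by
        have h := dlField_inl_inv θs (W.lphase (θ t) q) ⟨j, hj⟩
        rw [hθpart, hqpart, hFI] at h
        exact h
      rw [hval]; exact hVθ j
    · have hval : W.dlField θs (W.lphase (θ t) q) (Sum.inl j) = Vθ j := by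
        have h := dlField_inl_load θs (W.lphase (θ t) q) ⟨j, hj⟩
        rw [hθpart, hqpart, dlFieldL, hFI, hmL, Matrix.mulVec_zero, add_zero, ← hVL] at h
        exact h
      rw [hval]; exact hVθ j
  | inr i =>
    show HasDerivAt (fun s => p s i - W.Dc i.1 * W.avgFrequency)
      (W.dlField θs (W.lphase (θ t) q) (Sum.inr i)) t
    have hval : W.dlField θs (W.lphase (θ t) q) (Sum.inr i) = W.dlFieldP θs (θ t) q i := rfl
    rw [hval, hFP i]
    exact ((hsol t).1 i).2.sub_const (W.Dc i.1 * W.avgFrequency)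

/-- The angle part of a state has sup norm at most that of the state. [folklore] -/
private theorem norm_inl_le (x : Fin n ⊕ W.Inv → ℝ) : ‖fun j => x (Sum.inl j)‖ ≤ ‖x‖ :=
  (pi_norm_le_iff_of_nonneg (norm_nonneg x)).2 fun j => norm_le_pi_norm x (Sum.inl j)

/-- **SPDB2013 Theorem 8 (ii), stability clause, WITH LOAD NODES, for the printed
differential-algebraic closed loop — the equilibrium `(θ*, p* = D_Iω_avg)` is locally exponentially
stable modulo the uniform rotation of the angles; certificate form.**  Hypotheses: `D_i ≥ 0` with at
least one inverter `i₀` (`V_I = {D_i > 0}` carry the droop and the secondary variable, `V_L = {D_i = 0}`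
are algebraic power-balance rows), gains `k_i > 0`, `|Y|` symmetric, symmetric communication weights
among the inverters; `θ*` an (Aux)-equilibrium (Theorem 2 (ii)'s angle array, loads included:
`P*_i − D_iω_avg = P_e,i(θ*)` at every node); the PSD + kernel certificates for the linearised
network form `u ↦ Σ_i u_i Σ_j a_ij cos(θ*_i − θ*_j)(u_i − u_j)` (all nodes; e.g. the arc
`θ* ∈ Δ_G(γ)`, `γ < π/2`: `DroopNetwork.posCurvature_of_arc`) and for the communication Laplacian
(inverters; e.g. `c ≥ 0` connected: `commFormI_certificate_of_connected`).  Conclusion: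
`∃ ρ, k, λ > 0` such that EVERY solution `(θ, p)` of (load – closed loop)–(secondary control – closed
loop) (`IsSolutionLoadsAt` at every time: inverter and secondary rows differential, load rows
algebraic) with `‖(θ(0) − θ*, p(0) − D_Iω_avg)‖ < ρ` satisfies, for all `t ≥ 0`,
`‖(θ(t) − (θ* + c𝟙), p(t) − D_Iω_avg)‖ ≤ k‖(θ(0) − (θ* + c𝟙), p(0) − D_Iω_avg)‖e^{−λt}`,
`c = (Σ_i D_i(θ_i(0) − θ*_i) − Σ_{V_I} k_i(p_i(0) − D_iω_avg))/Σ_i D_i` (sup norm on `ℝⁿ × ℝ^{V_I}`):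
exponential convergence to the point `(θ* + c𝟙, D_Iω_avg)` of the equilibrium manifold.
The proof is the printed one made quantitative: `L_LL(θ*)` is nonsingular («regular fixed point»),
the algebraic equations are differentiated and solved for the load velocities so that the DAE
solution solves the Kron-extended flow `x' = dlField θ* x` (`hasDerivAt_lphase_of_isSolutionLoadsAt`),
whose linearisation is `−Z⁻¹X₁X₂` extended by neutral load directions (`dlJac_eig_re_neg_or_rotation`);
Lyapunov's indirect method in the rotation-quotient form gives the estimate within the leaves of the
conserved quantity `Σ D_iθ_i − Σ_{V_I} k_ip̃_i`, and a continuity (bootstrap) argument keeps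
`L_LL(θ(t))` invertible along the solution.  MODEL: droop-controlled inverters with the DAPI secondary
loop and constant-power loads (algebraic rows), lossless lines, constant voltage amplitudes;
`ρ, k, λ` EXISTENTIAL.  NOT typed here: the equivalence (i) ⇔ (ii) (existence / uniqueness of `θ*` is
Theorem 2, `DroopControlledInverters.lean` / `DroopSyncExponentialStabilityLoads.lean`), the
power-sharing clause.
[cite: SimpsonporcoDorflerBullo2013, §5 Theorem 8 (ii) («the system (load – closed loop)–(secondary control – closed loop) possess a locally exponentially stable and unique equilibrium `(θ*, p*) ∈ Δ_G(γ) × ℝ^{|V_I|}` … `p*_i = D_iω_avg` for `i ∈ V_I`», held text p0012 L56–L70) and App. C (p0016 L1–L40)] -/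
theorem equilibrium_locally_expStable_loads_of_certificates (hD : ∀ i, 0 ≤ W.Dc i) (i₀ : W.Inv)
    (hk : ∀ i : W.Inv, 0 < W.kgain i.1) (hY : ∀ i j, W.Yabs i j = W.Yabs j i)
    (hcs : ∀ i j : W.Inv, W.comm i.1 j.1 = W.comm j.1 i.1) {θs : Fin n → ℝ}
    (hθs : W.IsAuxEquilibrium θs)
    (hpsd : ∀ u : Fin n → ℝ, 0 ≤ ∑ i, u i * ∑ j, W.linWeight θs i j * (u i - u j))
    (hker : ∀ u : Fin n → ℝ, ∑ i, u i * ∑ j, W.linWeight θs i j * (u i - u j) = 0 →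
      ∃ a : ℝ, u = fun _ => a)
    (hcpsd : ∀ u : W.Inv → ℝ, 0 ≤ ∑ i, u i * ∑ j, W.comm i.1 j.1 * (u i - u j))
    (hcker : ∀ u : W.Inv → ℝ, ∑ i, u i * ∑ j, W.comm i.1 j.1 * (u i - u j) = 0 →
      ∃ a : ℝ, u = fun _ => a) :
    ∃ ρ > 0, ∃ k > 0, ∃ lam > 0, ∀ (θ : ℝ → Fin n → ℝ) (p : ℝ → W.Inv → ℝ),
      (∀ t, W.IsSolutionLoadsAt θ p t) →
      ‖W.lphase (θ 0 - θs) (fun i => p 0 i - W.Dc i.1 * W.avgFrequency)‖ < ρ →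
      ∀ t : ℝ, 0 ≤ t →
        ‖W.lphase (fun j => θ t j - (θs j + (∑ j', W.Dc j' * (θ 0 j' - θs j')
              - ∑ i : W.Inv, W.kgain i.1 * (p 0 i - W.Dc i.1 * W.avgFrequency)) / ∑ j', W.Dc j'))
            (fun i => p t i - W.Dc i.1 * W.avgFrequency)‖
          ≤ k * ‖W.lphase (fun j => θ 0 j - (θs j + (∑ j', W.Dc j' * (θ 0 j' - θs j')
              - ∑ i : W.Inv, W.kgain i.1 * (p 0 i - W.Dc i.1 * W.avgFrequency)) / ∑ j', W.Dc j'))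
            (fun i => p 0 i - W.Dc i.1 * W.avgFrequency)‖ * Real.exp (-lam * t) := by
  classical
  obtain ⟨ρ, hρ, k, hk', lam, hlam, H⟩ :=
    dl_expStable_within_leaf hD i₀ hk hY hcs hθs hpsd hker hcpsd hcker
  have Hmod := dl_expStable_modRotation_of_within_leaf hD i₀ hk H
  have hDs : 0 < ∑ i, W.Dc i :=
    lt_of_lt_of_le i₀.2 (Finset.single_le_sum (fun i _ => hD i) (Finset.mem_univ i₀.1))
  obtain ⟨K, hKdef⟩ : ∃ K : ℝ, K = (∑ i, W.Dc i + ∑ i : W.Inv, W.kgain i.1) / ∑ i, W.Dc i :=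
    ⟨_, rfl⟩
  have hK0 : 0 ≤ K := hKdef ▸ div_nonneg
    (add_nonneg hDs.le (Finset.sum_nonneg fun i _ => (hk i).le)) hDs.le
  rw [← hKdef] at Hmod
  have hU0 : IsUnit (W.lapLL θs).det :=
    DroopNetwork.isUnit_lapLL_det (N := W.toDroopNetwork) hker i₀
  obtain ⟨r, hr, hball⟩ := DroopNetwork.exists_ball_isUnit_lapLL (N := W.toDroopNetwork) hU0
  -- the radius: small enough for the estimate AND to keep `L_LL` invertible along the motion
  set ρ' : ℝ := min (ρ / (1 + K)) (r / ((1 + K) * (k + 2))) with hρ'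
  have hρ'pos : 0 < ρ' := lt_min (by positivity) (by positivity)
  have hρ'ρ : ρ' ≤ ρ / (1 + K) := min_le_left _ _
  have hρ'r : (1 + K) * (k + 2) * ρ' ≤ r := by
    have := min_le_right (ρ / (1 + K)) (r / ((1 + K) * (k + 2)))
    rw [← hρ'] at this
    calc (1 + K) * (k + 2) * ρ' ≤ (1 + K) * (k + 2) * (r / ((1 + K) * (k + 2))) :=
          mul_le_mul_of_nonneg_left this (by positivity)
      _ = r := by field_simp
  set B : ℝ := (1 + K) * ρ' with hBdef
  have hBpos : 0 < B := by positivity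
  have hkB : k * B + 2 * B ≤ r := by
    have h : k * B + 2 * B = (1 + K) * (k + 2) * ρ' := by rw [hBdef]; ring
    rw [h]; exact hρ'r
  have hkBnn : 0 ≤ k * B := by positivity
  have hBr : B < r := by linarith
  have hkBr : k * B < r := by linarith
  refine ⟨ρ', hρ'pos, k, hk', lam, hlam, fun θ p hsol h0 t ht => ?_⟩
  -- the state curve and its properties
  set x₀ : Fin n ⊕ W.Inv → ℝ := W.lphase θs 0 with hx₀
  set X : ℝ → Fin n ⊕ W.Inv → ℝ :=
    fun s => W.lphase (θ s) (fun i => p s i - W.Dc i.1 * W.avgFrequency) with hXdef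
  have hXderiv : ∀ s, ∃ V : Fin n ⊕ W.Inv → ℝ, HasDerivAt X V s :=
    fun s => exists_hasDerivAt_lphase_of_isSolutionLoadsAt hsol s
  have hXcont : Continuous X :=
    continuous_iff_continuousAt.2 fun s => (hXderiv s).choose_spec.continuousAt
  have hθX : ∀ s, (fun j => X s (Sum.inl j)) = θ s := fun s => rfl
  have hθcont : Continuous θ := by
    have h1 : θ = fun s j => X s (Sum.inl j) := funext fun s => (hθX s).symm
    rw [h1]
    exact continuous_pi fun j => (continuous_apply (Sum.inl j)).comp hXcont
  -- velocity = extended field wherever `L_LL(θ s)` is invertible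
  have hvel : ∀ s, IsUnit (W.lapLL (θ s)).det → HasDerivAt X (W.dlField θs (X s)) s :=
    fun s hUs => hasDerivAt_lphase_of_isSolutionLoadsAt hD hsol θs hUs
  -- the rotation selected by the conserved quantity
  set c : ℝ := W.dlWeights ⬝ᵥ (X 0 - x₀) / ∑ i, W.Dc i with hcdef
  have hcle : |c| ≤ K * ‖X 0 - x₀‖ := by
    rw [hcdef, abs_div, abs_of_pos hDs, div_le_iff₀ hDs, hKdef]
    calc |W.dlWeights ⬝ᵥ (X 0 - x₀)| ≤ (∑ i, W.Dc i + ∑ i : W.Inv, W.kgain i.1) * ‖X 0 - x₀‖ :=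
          abs_dlWeights_dotProduct_le hD (fun i => (hk i).le) _
      _ = (∑ i, W.Dc i + ∑ i : W.Inv, W.kgain i.1) / (∑ i, W.Dc i) * ‖X 0 - x₀‖ * ∑ i, W.Dc i := by
          field_simp
  have hdev : X 0 - x₀ = W.lphase (θ 0 - θs) (fun i => p 0 i - W.Dc i.1 * W.avgFrequency) := by
    funext kk
    cases kk with
    | inl j => simp [hXdef, hx₀, lphase]
    | inr i => simp [hXdef, hx₀, lphase]
  have h0X : ‖X 0 - x₀‖ < ρ' := by rw [hdev]; exact h0
  -- the estimate on any interval where `L_LL` stays invertible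
  have hest : ∀ T : ℝ, (∀ s ∈ Icc 0 T, IsUnit (W.lapLL (θ s)).det) →
      ∀ s ∈ Icc 0 T, ‖X s - fun kk => x₀ kk + c * W.dlRot kk‖
        ≤ k * ‖X 0 - fun kk => x₀ kk + c * W.dlRot kk‖ * Real.exp (-lam * s) := by
    intro T hT s hs
    have hsolF : ∀ s ∈ Icc 0 T, HasDerivWithinAt X (W.dlField θs (X s)) (Icc 0 T) s :=
      fun s hs => (hvel s (hT s hs)).hasDerivWithinAt
    exact Hmod X T hsolF (lt_of_lt_of_le h0X hρ'ρ) s hs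
  have hbound0 : ‖X 0 - fun kk => x₀ kk + c * W.dlRot kk‖ ≤ B := by
    have hdecomp : (X 0 - fun kk => x₀ kk + c * W.dlRot kk) = (X 0 - x₀) - fun kk => c * W.dlRot kk := by
      funext kk; simp; ring
    have hrot : ‖fun kk : Fin n ⊕ W.Inv => c * W.dlRot kk‖ ≤ |c| := by
      refine (pi_norm_le_iff_of_nonneg (abs_nonneg c)).2 fun kk => ?_
      cases kk with
      | inl i => simp [dlRot]
      | inr i => simp [dlRot]
    have hKX : K * ‖X 0 - x₀‖ ≤ K * ρ' := mul_le_mul_of_nonneg_left h0X.le hK0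
    rw [hdecomp]
    calc ‖(X 0 - x₀) - fun kk : Fin n ⊕ W.Inv => c * W.dlRot kk‖
        ≤ ‖X 0 - x₀‖ + ‖fun kk : Fin n ⊕ W.Inv => c * W.dlRot kk‖ := norm_sub_le _ _
      _ ≤ ρ' + K * ρ' := by linarith [hrot, hcle, h0X.le]
      _ = B := by rw [hBdef]; ring
  have hsmall : ∀ T : ℝ, (∀ s ∈ Icc 0 T, IsUnit (W.lapLL (θ s)).det) →
      ∀ s ∈ Icc 0 T, ‖X s - fun kk => x₀ kk + c * W.dlRot kk‖ ≤ k * B := by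
    intro T hT s hs
    have h1 := hest T hT s hs
    have hexp : Real.exp (-lam * s) ≤ 1 := Real.exp_le_one_iff.2 (by nlinarith [hs.1])
    calc ‖X s - fun kk => x₀ kk + c * W.dlRot kk‖
        ≤ k * ‖X 0 - fun kk => x₀ kk + c * W.dlRot kk‖ * Real.exp (-lam * s) := h1
      _ ≤ k * ‖X 0 - fun kk => x₀ kk + c * W.dlRot kk‖ := mul_le_of_le_one_right (by positivity) hexp
      _ ≤ k * B := mul_le_mul_of_nonneg_left hbound0 hk'.le
  -- the angle part of the deviation controls `L_LL`
  have hθpart : ∀ s, ‖θ s - fun j => θs j + c‖ ≤ ‖X s - fun kk => x₀ kk + c * W.dlRot kk‖ := by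
    intro s
    have h := norm_inl_le (W := W) (X s - fun kk => x₀ kk + c * W.dlRot kk)
    have hj : (fun j => (X s - fun kk => x₀ kk + c * W.dlRot kk) (Sum.inl j))
        = θ s - fun j => θs j + c := by
      funext j; simp [hXdef, hx₀, lphase, dlRot]
    rw [hj] at h
    exact h
  -- BOOTSTRAP: `L_LL(θ s)` stays invertible for all `s ≥ 0`
  have hinv : ∀ s, 0 ≤ s → IsUnit (W.lapLL (θ s)).det := by
    by_contra hcon
    push Not at hcon
    set S : Set ℝ := {s | 0 ≤ s ∧ ¬ IsUnit (W.lapLL (θ s)).det} with hSdef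
    have hSne : S.Nonempty := by obtain ⟨s, hs, hsU⟩ := hcon; exact ⟨s, hs, hsU⟩
    have hSbdd : BddBelow S := ⟨0, fun s hs => hs.1⟩
    have hSclosed : IsClosed S := by
      have h1 : S = Set.Ici 0 ∩ (fun s => (W.lapLL (θ s)).det) ⁻¹' {0} := by
        ext s
        simp only [hSdef, Set.mem_setOf_eq, Set.mem_inter_iff, Set.mem_Ici, Set.mem_preimage,
          Set.mem_singleton_iff, isUnit_iff_ne_zero, not_not]
      rw [h1]
      exact isClosed_Ici.inter (isClosed_singleton.preimage
        ((continuous_lapLL' (W := W)).matrix_det.comp hθcont))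
    set T₀ : ℝ := sInf S with hT₀
    have hT₀mem : T₀ ∈ S := hSclosed.csInf_mem hSne hSbdd
    have hT₀nonneg : 0 ≤ T₀ := hT₀mem.1
    have hbefore : ∀ s, 0 ≤ s → s < T₀ → IsUnit (W.lapLL (θ s)).det := by
      intro s hs hsT
      by_contra hsU
      exact absurd (csInf_le hSbdd ⟨hs, hsU⟩) (not_le.2 hsT)
    -- at time 0 the matrix is invertible, so `T₀ > 0`
    have hU_X0 : IsUnit (W.lapLL (θ 0)).det := by
      refine hball (θ 0) c ?_
      calc ‖θ 0 - fun j => θs j + c‖ ≤ ‖X 0 - fun kk => x₀ kk + c * W.dlRot kk‖ := hθpart 0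
        _ ≤ B := hbound0
        _ < r := hBr
    have hT₀pos : 0 < T₀ := by
      rcases hT₀nonneg.lt_or_eq with h | h
      · exact h
      · exact absurd (h ▸ hU_X0) hT₀mem.2
    -- on `[0, T₀)` the estimate holds; pass to the limit `s → T₀⁻`
    have hle : ∀ s, 0 ≤ s → s < T₀ → ‖X s - fun kk => x₀ kk + c * W.dlRot kk‖ ≤ k * B := by
      intro s hs hsT
      exact hsmall s (fun s' hs' => hbefore s' hs'.1 (lt_of_le_of_lt hs'.2 hsT)) s ⟨hs, le_rfl⟩
    have hlim : ‖X T₀ - fun kk => x₀ kk + c * W.dlRot kk‖ ≤ k * B := by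
      have htend : Tendsto (fun s => ‖X s - fun kk => x₀ kk + c * W.dlRot kk‖) (𝓝[<] T₀)
          (𝓝 ‖X T₀ - fun kk => x₀ kk + c * W.dlRot kk‖) :=
        ((hXcont.sub continuous_const).norm.continuousAt).continuousWithinAt.tendsto
      refine le_of_tendsto htend ?_
      have hmem : Ioo 0 T₀ ∈ 𝓝[<] T₀ := Ioo_mem_nhdsLT hT₀pos
      filter_upwards [hmem] with s hs
      exact hle s hs.1.le hs.2
    have hU_T₀ : IsUnit (W.lapLL (θ T₀)).det := by
      refine hball (θ T₀) c ?_
      calc ‖θ T₀ - fun j => θs j + c‖ ≤ ‖X T₀ - fun kk => x₀ kk + c * W.dlRot kk‖ := hθpart T₀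
        _ ≤ k * B := hlim
        _ < r := hkBr
    exact hT₀mem.2 hU_T₀
  -- conclusion at time `t`
  have key := hest t (fun s hs => hinv s hs.1) t ⟨ht, le_rfl⟩
  have hcval : W.dlWeights ⬝ᵥ (X 0 - x₀) = ∑ j', W.Dc j' * (θ 0 j' - θs j')
      - ∑ i : W.Inv, W.kgain i.1 * (p 0 i - W.Dc i.1 * W.avgFrequency) := by
    rw [hdev]
    simp only [dotProduct, Fintype.sum_sum_type, dlWeights, lphase, Sum.elim_inl, Sum.elim_inr,
      Pi.sub_apply, neg_mul, Finset.sum_neg_distrib]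
    ring
  have hc' : c = (∑ j', W.Dc j' * (θ 0 j' - θs j')
      - ∑ i : W.Inv, W.kgain i.1 * (p 0 i - W.Dc i.1 * W.avgFrequency)) / ∑ j', W.Dc j' := by
    rw [hcdef, hcval]
  have hshape : ∀ (C : ℝ) (s : ℝ), (X s - fun kk => x₀ kk + C * W.dlRot kk)
      = W.lphase (fun j => θ s j - (θs j + C)) (fun i => p s i - W.Dc i.1 * W.avgFrequency) := by
    intro C s
    funext kk
    cases kk with
    | inl j => simp [hXdef, hx₀, lphase, dlRot]
    | inr i => simp [hXdef, hx₀, lphase, dlRot]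
  rw [hc', hshape, hshape] at key
  exact key

/-- **Theorem 8 (ii), stability clause WITH LOAD NODES, printed hypotheses** for the
differential-algebraic closed loop: `θ* ∈ Δ_G(γ)`, `γ < π/2` (`|θ*_i − θ*_j| < π/2` across every
coupled pair), couplings `a_ij ≥ 0` with a connected coupling graph, communication weights `c_ij ≥ 0`
among the inverters with a connected communication graph (cut form), `D ≥ 0` with at least one
inverter, `k_i > 0`.
[cite: SimpsonporcoDorflerBullo2013, §5 Theorem 8 (ii) and App. C; §3 proof of Theorem 2 (b) («`L(θ*)` … positive semidefinite»)] -/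
theorem equilibrium_locally_expStable_loads (hD : ∀ i, 0 ≤ W.Dc i) (i₀ : W.Inv)
    (hk : ∀ i : W.Inv, 0 < W.kgain i.1) (hY : ∀ i j, W.Yabs i j = W.Yabs j i)
    (ha : ∀ i j, 0 ≤ W.a i j) (hconn : ClassicalModel.CouplingConnected W.a)
    (hcs : ∀ i j : W.Inv, W.comm i.1 j.1 = W.comm j.1 i.1) (hc0 : ∀ i j : W.Inv, 0 ≤ W.comm i.1 j.1)
    (hcconn : ∀ S : Finset W.Inv, S.Nonempty → Sᶜ.Nonempty → ∃ i ∈ S, ∃ j ∈ Sᶜ, 0 < W.comm i.1 j.1)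
    {θs : Fin n → ℝ} (hθs : W.IsAuxEquilibrium θs)
    (harc : ∀ i j, i ≠ j → 0 < W.a i j → |θs i - θs j| < Real.pi / 2) :
    ∃ ρ > 0, ∃ k > 0, ∃ lam > 0, ∀ (θ : ℝ → Fin n → ℝ) (p : ℝ → W.Inv → ℝ),
      (∀ t, W.IsSolutionLoadsAt θ p t) →
      ‖W.lphase (θ 0 - θs) (fun i => p 0 i - W.Dc i.1 * W.avgFrequency)‖ < ρ →
      ∀ t : ℝ, 0 ≤ t →
        ‖W.lphase (fun j => θ t j - (θs j + (∑ j', W.Dc j' * (θ 0 j' - θs j')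
              - ∑ i : W.Inv, W.kgain i.1 * (p 0 i - W.Dc i.1 * W.avgFrequency)) / ∑ j', W.Dc j'))
            (fun i => p t i - W.Dc i.1 * W.avgFrequency)‖
          ≤ k * ‖W.lphase (fun j => θ 0 j - (θs j + (∑ j', W.Dc j' * (θ 0 j' - θs j')
              - ∑ i : W.Inv, W.kgain i.1 * (p 0 i - W.Dc i.1 * W.avgFrequency)) / ∑ j', W.Dc j'))
            (fun i => p 0 i - W.Dc i.1 * W.avgFrequency)‖ * Real.exp (-lam * t) := by
  obtain ⟨hpsd, hker⟩ :=
    DroopNetwork.posCurvature_of_arc (N := W.toDroopNetwork) ha hconn hY harc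
  obtain ⟨hcpsd, hcker⟩ := commFormI_certificate_of_connected hcs hc0 hcconn
  exact equilibrium_locally_expStable_loads_of_certificates hD i₀ hk hY hcs hθs hpsd hker hcpsd hcker

end DAPINetwork

end Literature.MathematicalPhysics.PowerSystems

end
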